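import Literature.Analysis.ValidatedNumerics.TrigLogTables
import Literature.NumberTheory.LFunctions.EulerMaclaurinZeta
import Literature.NumberTheory.LFunctions.MertensZeroCertificate
import HarnessLib

/-!
# Backlund's certificate for the Riemann hypothesis up to a given height (`T = 16`)

Trunk T-ANT (`NumberTheory/LFunctions`) with T-VALNUM. A kernel-checkable certificate format
`Literature.NumberTheory.LFunctions.ZetaCert.RHCert`, its Boolean checker `RHCert.check`, the soundness theorem
`RHCert.sound : C.check = true → Literature.RiemannHypothesisUpTo C.T`, the packaging
`Literature.RH.ZetaCert.backlundVerifier : Literature.RHVerifier` (the statement shape of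
`NamedHypotheses.lean`; cf. `Literature.goldbachVerifier`), and the accepted certificate for `T = 16`:
`Literature.riemannHypothesisUpTo_sixteen : RiemannHypothesisUpTo 16` (consumed by
`KatkovaPF44Proofs.lean`, `45 ≤ 16π`).

The method is Backlund's (1914) [Edwards1974, §6.6], in the exact-count form already in the
tree:

1. **`N(T)` from the top edge alone.** If `ζ` is covered along `[½, 2] × {T}` by a valid piece
   list in the sense of `Literature/Analysis/Complex/WindingCertificate.lean`
   (`Literature.Analysis.Complex.HPieces`: on each sub-segment `Re((-i)^d ζ) > 0` for a label `d : Fin 4`), then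
   `N(T)` is determined by the labels and Stirling's approximation of `θ(T)`
   (`Literature.NumberTheory.LFunctions.MertensZeroCertificate.zetaZeroCount_eq_of_hpieces_stirling`, `MertensZeroCertificate.lean`, from Backlund's
   formula `Literature.NumberTheory.LFunctions.pi_mul_zetaArgS_eq`).
2. **`N₀(T)` from brackets.** Each pair `t₁ < t₂ ≤ T` with `Re(ζ(½+it₁) conj ζ(½+it₂)) < 0`,
   `t₂ - t₁ ≤ 1/8`, encloses a zero on the critical line (twisted sign test,
   `Literature.NumberTheory.LFunctions.exists_zero_Icc_of_re_mul_conj_neg'`), and separated brackets give distinct zeros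
   (`Literature.NumberTheory.LFunctions.criticalZeroCount_add_card_le`, `TuringMethod.lean`).
3. **Turing's reduction** `N(T) ≤ N₀(T) → RiemannHypothesisUpTo T`
   (`Literature.NumberTheory.DiophantineGeometry.RiemannHypothesisUpTo.of_zetaZeroCount_le_criticalZeroCount`).

## Relation to the tree's certified `ζ`-numerics, and what is added

Two certified evaluators of `ζ` exist in the tree. (a) `ZetaLowHeightZeros.lean`
(`Literature.RH.ZetaNum`): box enclosures `zetaEncl` of `ζ, ζ', ζ''` by Euler–Maclaurin with the fixed
cut-off `N = 6` in the fixed-point arithmetic `Literature.Numerics.FI/CB`, a first-order piece test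
`pieceCheck` and edge checkers `hEdgeCheck`/`vEdgeCheck` with `hEdgeCheck_sound : … → HPieces`,
used for `ζ, ζ' ≠ 0` on `(0, ½) × (0, 11]`. It cannot serve here: its `cpowNegBox` evaluates
`n^{-σ}` through `FI.expSmall`, whose domain is `|σ log n| ≤ 1`, so `zetaEncl` declines
(`none`) as soon as `σ log 6 > 1`, i.e. for `σ > 0.558` — on essentially all of the edge
`[½, 2] × {T}` at every height (checked: `zetaEncl` of the point `⅝ + 16i` is `none`); and at
`½ + 14i` its remainder radius (`R0 ≈ 0.19`, growing like `|s|⁵/6^{4.5}`) exceeds by two orders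
of magnitude the accuracy `≈ 2·10⁻³` that a bracket around `γ₁` requires. (b)
`ZetaCertifiedEvaluation.lean` (`Literature.NumberTheory.LFunctions.ZetaNumerics.zetaBox`, with its own `Tables`/`mem_zetaBox`):
arbitrary order and precision in the multi-precision arithmetic `Literature.NumericsMP`, designed for
`native_decide` (memoised arrays, ~90-digit values for the Odlyzko–te Riele computation), not for
evaluation by the kernel. The present third layer is the kernel-evaluable middle ground:

* **Part 1 — point enclosures with a variable cut-off.** `Node.zetaBox`, `Node.zeta1Box ∋ ζ(s),
  ζ'(s)` at a rational point `s = σ + it`, `σ ≥ 0`, from the order-two Euler–Maclaurin formula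
  (`Literature.NumberTheory.LFunctions.riemannZeta_eq_emMain_add_emRem₂`, `norm_emRem₂_le`, `norm_emRem₂D_le`,
  [Edwards1974, §6.4]) with any cut-off `N ≤ K`; `n^{-σ} = e^{-σ log n}` by range reduction
  `(e^{-x/16})^{16}` over `FI.expSmall` (`expNegD`, any `σ log n ≤ 16`) from the kernel-validated
  table `FI.logTable K` of `TrigLogTables.lean`; and a bound `M2bound ≥ sup |ζ''|` on a region
  `Re s ≥ σ₀, |s| ≤ M0, |s-1| ≥ m1` (`norm_deriv2_zeta_le`).
* **Part 2 — pieces of the top edge.** A `Piece` is a horizontal segment between two nodes with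
  rational end points and a label `d : Fin 4`; `Piece.check` is the second-order Taylor test
  `lo Re((-i)^d ζ(a)) - (ℓ/2)·hi|Re((-i)^d ζ'(a))| - (ℓ²/8)·M2 > 0` from both end points (each
  covering half of the segment, `norm_sub_taylor_le`; only point values of `ζ, ζ'` are needed),
  and `hpieces_realize` turns a checked, chained list of pieces into an `Literature.Analysis.Complex.HPieces`
  certificate for `ζ`, the input of `zetaZeroCount_eq_of_hpieces_stirling`.
* **Part 3 — brackets** (`Bracket.check`, `Bracket.exists_zero`,
  `criticalZeroCount_add_length_le`) and the **Stirling inequality** of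
  `zetaZeroCount_eq_of_hpieces_stirling` in interval arithmetic (`stirlingCheck`; `log π` and
  `log T` from `FI.logOneSub`, `FI.pi`).
* **Part 4 — `RHCert`, `RHCert.check`, `RHCert.sound`, `backlundVerifier`.**
* **Part 5 — the certificate for `T = 16`** (`RH16.theCert`: two pieces `[½, 3/2]`, `[3/2, 2]`
  with label `0`, i.e. `Re ζ(σ + 16i) > 0`; one bracket `[225/16, 227/16]` around
  `γ₁ = 14.1347…`; `K = 20`), `RH16.theCert_check` by `decide +kernel`, and
  `Literature.NumberTheory.LFunctions.riemannHypothesisUpTo_sixteen`.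

Everything is proved (no named facts). Scope of the format: heights `2 ≤ T ≤ 2²⁰`; the caller
must supply pieces fine enough for the Taylor test (any rational abscissae in `[½, 2]`) and one
bracket of width `≤ 1/8` per zero with ordinate in `(0, T]` (so `N(T)` simple zeros on the line,
located to within `1/8` and separated from each other).

## References

* H. M. Edwards, *Riemann's Zeta Function*, Academic Press 1974, §6.4 (Euler–Maclaurin with
  remainder), §6.6 (Backlund's determination of `N(T)`). [Edwards1974]
* E. C. Titchmarsh, *The Theory of the Riemann Zeta-Function*, 2nd ed. 1986, Thm. 9.3, §15.2.
  [Titchmarsh1986]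
* R. P. Brent, *On the zeros of the Riemann zeta function in the critical strip*, Math. Comp. 33
  (1979), §3 (brackets on the line). [Brent1979]
* R. E. Moore, *Interval Analysis*, Prentice-Hall 1966 (inclusion property). [folklore]
-/

noncomputable section

open Literature.Analysis.ValidatedNumerics.Numerics Literature.Analysis.Complex Complex Set MeasureTheory intervalIntegral
open scoped Real ComplexConjugate

namespace Literature.NumberTheory.LFunctions.ZetaCert

/-! ## Gaussian rationals -/

/-- A Gaussian rational `re + im·i`. [folklore] -/
structure QC where
  /-- real part -/
  re : ℚ
  /-- imaginary part -/
  im : ℚ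
  deriving DecidableEq

namespace QC

/-- The complex number. [folklore] -/
@[coe] def toC (z : QC) : ℂ := ⟨z.re, z.im⟩

/-- Real part. [folklore] -/
@[simp] lemma toC_re (z : QC) : z.toC.re = z.re := rfl

/-- Imaginary part. [folklore] -/
@[simp] lemma toC_im (z : QC) : z.toC.im = z.im := rfl

/-- Sum. [folklore] -/
def add (a b : QC) : QC := ⟨a.re + b.re, a.im + b.im⟩
/-- Difference. [folklore] -/
def sub (a b : QC) : QC := ⟨a.re - b.re, a.im - b.im⟩
/-- Product. [folklore] -/
def mul (a b : QC) : QC := ⟨a.re * b.re - a.im * b.im, a.re * b.im + a.im * b.re⟩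
/-- `|z|²`. [folklore] -/
def normSq (a : QC) : ℚ := a.re ^ 2 + a.im ^ 2
/-- Inverse (`0⁻¹ = 0`). [folklore] -/
def inv (a : QC) : QC := ⟨a.re / a.normSq, -a.im / a.normSq⟩
/-- A rational as a Gaussian rational. [folklore] -/
def ofRat (q : ℚ) : QC := ⟨q, 0⟩

/-- `toC` is additive. [folklore] -/
@[simp] lemma toC_add (a b : QC) : (a.add b).toC = a.toC + b.toC := by
  apply Complex.ext <;> simp [add, toC]

/-- `toC` respects subtraction. [folklore] -/
@[simp] lemma toC_sub (a b : QC) : (a.sub b).toC = a.toC - b.toC := by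
  apply Complex.ext <;> simp [sub, toC]

/-- `toC` is multiplicative. [folklore] -/
@[simp] lemma toC_mul (a b : QC) : (a.mul b).toC = a.toC * b.toC := by
  apply Complex.ext <;> simp [mul, toC]

/-- `toC (ofRat q) = q`. [folklore] -/
@[simp] lemma toC_ofRat (q : ℚ) : (ofRat q).toC = (q : ℂ) := by
  apply Complex.ext <;> simp [ofRat, toC]

/-- `normSq` agrees with `Complex.normSq`. [folklore] -/
lemma normSq_eq (a : QC) : (a.normSq : ℝ) = Complex.normSq a.toC := by
  simp [normSq, toC, Complex.normSq_apply]; ring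

/-- `toC` respects inverses (including `0⁻¹ = 0`). [folklore] -/
@[simp] lemma toC_inv (a : QC) : (a.inv).toC = a.toC⁻¹ := by
  apply Complex.ext
  · simp [inv, toC, Complex.inv_re, normSq, Complex.normSq_apply]; ring
  · simp [inv, toC, Complex.inv_im, normSq, Complex.normSq_apply, neg_div]; ring

/-- The point box of a Gaussian rational. [folklore] -/
def toCB (z : QC) : CB := ⟨FI.ofRat z.re, FI.ofRat z.im⟩

/-- `z ∈ toCB z`. [folklore] -/
lemma mem_toCB (z : QC) : CB.mem z.toC z.toCB := ⟨FI.mem_ofRat z.re, FI.mem_ofRat z.im⟩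

end QC

/-! ## Euler–Maclaurin coefficient functions in exact arithmetic -/

/-- `A(s) = N/(s-1) + ½ + s/(12N) - s(s+1)(s+2)/(720 N³)` over `ℚ[i]`. [cite: Edwards1974, §6.4 eq. (1)] -/
def emAQ (N : ℕ) (s : QC) : QC :=
  (((QC.ofRat N).mul (s.sub (QC.ofRat 1)).inv).add (QC.ofRat (1 / 2))).add
    ((s.mul (QC.ofRat (1 / (12 * N)))).sub
      ((s.mul ((s.add (QC.ofRat 1)).mul (s.add (QC.ofRat 2)))).mul (QC.ofRat (1 / (720 * N ^ 3)))))

/-- `A'(s) = -N/(s-1)² + 1/(12N) - (3s²+6s+2)/(720N³)` over `ℚ[i]`. [folklore] -/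
def emA₁Q (N : ℕ) (s : QC) : QC :=
  (((QC.ofRat (-(N : ℚ))).mul ((s.sub (QC.ofRat 1)).mul (s.sub (QC.ofRat 1))).inv).add
    (QC.ofRat (1 / (12 * N)))).sub
    (((((QC.ofRat 3).mul (s.mul s)).add ((QC.ofRat 6).mul s)).add (QC.ofRat 2)).mul
      (QC.ofRat (1 / (720 * N ^ 3))))

/-- `emAQ` computes `Literature.NumberTheory.LFunctions.emA`. [folklore] -/
lemma toC_emAQ (N : ℕ) (s : QC) : (emAQ N s).toC = Literature.NumberTheory.LFunctions.emA N s.toC := by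
  simp only [emAQ, Literature.NumberTheory.LFunctions.emA, QC.toC_add, QC.toC_sub, QC.toC_mul, QC.toC_inv, QC.toC_ofRat]
  push_cast
  ring

/-- `emA₁Q` computes `Literature.NumberTheory.LFunctions.emA₁`. [folklore] -/
lemma toC_emA₁Q (N : ℕ) (s : QC) : (emA₁Q N s).toC = Literature.NumberTheory.LFunctions.emA₁ N s.toC := by
  simp only [emA₁Q, Literature.NumberTheory.LFunctions.emA₁, QC.toC_add, QC.toC_sub, QC.toC_mul, QC.toC_inv, QC.toC_ofRat]
  push_cast
  ring

/-! ## Part 1. Point enclosures of `ζ`, `ζ'` with a variable cut-off -/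

/-! ### The logarithm table and `n^{-σ}` -/

/-- Validity of a logarithm table up to index `K`: `log n ∈ logs[n]` for `n ≤ K`. [folklore] -/
def LogsValid (logs : List FI) (K : ℕ) : Prop :=
  ∀ n ≤ K, FI.mem (Real.log n) (logs.getD n (FI.ofInt 0))

/-- The table test: the supplied logarithms coincide with `FI.logTable K` and the engine accepted
every logarithm step. [folklore] -/
def logsCheck (logs : List FI) (K : ℕ) : Bool :=
  decide (logs = FI.logTable K) && FI.logTableOK K

/-- **Soundness of `logsCheck`.** [folklore] -/
lemma logsValid_of_check {logs : List FI} {K : ℕ} (h : logsCheck logs K = true) :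
    LogsValid logs K := by
  simp only [logsCheck, Bool.and_eq_true, decide_eq_true_eq] at h
  intro n hn
  rw [h.1]
  exact FI.mem_logTable h.2 hn

/-- `e^{-x}` for `0 ≤ x ≤ 16` by range reduction: `(e^{-x/16})^{16}` through the engine's
`FI.expSmall` (domain `|·| ≤ 1`; total version, valid when `expNegOK`). [folklore] -/
def expNegD (X : FI) : FI := FI.pow ((FI.expSmall (X.divNat 16).neg).getD (FI.ofInt 0)) 16

/-- Did the engine accept the input of `expNegD`? [folklore] -/
def expNegOK (X : FI) : Bool := (FI.expSmall (X.divNat 16).neg).isSome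

/-- Soundness of `expNegD`. [folklore] -/
lemma mem_expNegD {x : ℝ} {X : FI} (hok : expNegOK X = true) (hx : FI.mem x X) :
    FI.mem (Real.exp (-x)) (expNegD X) := by
  obtain ⟨Y, hY⟩ := Option.isSome_iff_exists.1 hok
  have h1 : FI.mem (Real.exp (-(x / 16))) Y :=
    FI.mem_expSmall hY (FI.mem_neg (FI.mem_divNat hx (n := 16) (by norm_num)))
  have e : Real.exp (-x) = Real.exp (-(x / 16)) ^ 16 := by
    rw [← Real.exp_nat_mul]; congr 1; push_cast; ring
  rw [expNegD, hY, Option.getD_some, e]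
  exact FI.mem_pow h1 16

/-- `n^{-σ}` as an interval: `e^{-σ log n}` from the table. [folklore] -/
def powNeg (logs : List FI) (σ : ℚ) (n : ℕ) : FI :=
  expNegD ((FI.ofRat σ).mul (logs.getD n (FI.ofInt 0)))

/-- Validity flag of `powNeg logs σ n`. [folklore] -/
def powNegOK (logs : List FI) (σ : ℚ) (n : ℕ) : Bool :=
  expNegOK ((FI.ofRat σ).mul (logs.getD n (FI.ofInt 0)))

/-- Validity flags of `powNeg logs σ n` for `n = 1, …, m`. [folklore] -/
def powNegRangeOK (logs : List FI) (σ : ℚ) : ℕ → Bool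
  | 0 => true
  | m + 1 => powNegOK logs σ (m + 1) && powNegRangeOK logs σ m

/-- [folklore] -/
lemma powNegRangeOK_spec {logs : List FI} {σ : ℚ} {m : ℕ} (h : powNegRangeOK logs σ m = true) :
    ∀ n, 1 ≤ n → n ≤ m → powNegOK logs σ n = true := by
  induction m with
  | zero => intro n h1 h0; omega
  | succ m ih =>
    simp only [powNegRangeOK, Bool.and_eq_true] at h
    intro n h1 hn
    rcases Nat.lt_or_ge n (m + 1) with hlt | hge
    · exact ih h.2 n h1 (by omega)
    · have : n = m + 1 := by omega
      subst this; exact h.1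

/-- The real number `n^{-σ} = e^{-σ log n}`. [folklore] -/
def rpowNeg (σ : ℚ) (n : ℕ) : ℝ := Real.exp (-((σ : ℝ) * Real.log n))

/-- `n^{-σ} > 0`. [folklore] -/
lemma rpowNeg_pos (σ : ℚ) (n : ℕ) : 0 < rpowNeg σ n := Real.exp_pos _

/-- `n^{-σ}` as a real power. [folklore] -/
lemma rpow_neg_eq_rpowNeg {n : ℕ} (hn : 1 ≤ n) (σ : ℚ) : (n : ℝ) ^ (-(σ : ℝ)) = rpowNeg σ n := by
  have hn' : (0 : ℝ) < n := by exact_mod_cast (show 0 < n by omega)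
  rw [Real.rpow_def_of_pos hn', rpowNeg]; congr 1; ring

/-- **`n^{-σ} ∈ powNeg`.** [folklore] -/
lemma mem_powNeg {logs : List FI} {K : ℕ} (hl : LogsValid logs K) {σ : ℚ} {n : ℕ} (hnK : n ≤ K)
    (hok : powNegOK logs σ n = true) : FI.mem (rpowNeg σ n) (powNeg logs σ n) :=
  mem_expNegD hok (FI.mem_mul (FI.mem_ofRat σ) (hl n hnK))

/-! ### Nodes -/

/-- A point `s = σ + i t` (`σ, t ∈ ℚ`) together with its Euler–Maclaurin cut-off `N` and a
claimed bound `M0 ≥ |s|`. [folklore] -/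
structure Node where
  /-- the real part -/
  σ : ℚ
  /-- the imaginary part -/
  t : ℚ
  /-- Euler–Maclaurin cut-off -/
  N : ℕ
  /-- claimed upper bound for `|s|` -/
  M0 : ℚ

namespace Node

variable (nd : Node)

/-- The point as a Gaussian rational. [folklore] -/
def sQ : QC := ⟨nd.σ, nd.t⟩

/-- The point `s ∈ ℂ`. [folklore] -/
def s : ℂ := nd.sQ.toC

/-- `Re s = σ`. [folklore] -/
@[simp] lemma s_re : nd.s.re = (nd.σ : ℝ) := by simp [s, sQ]

/-- `Im s = t`. [folklore] -/
@[simp] lemma s_im : nd.s.im = (nd.t : ℝ) := by simp [s, sQ]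

/-- Cartesian form of the node. [folklore] -/
lemma s_eq : nd.s = ((nd.σ : ℝ) : ℂ) + (nd.t : ℝ) * I := by
  apply Complex.ext <;> simp

/-- Basic admissibility: `1 ≤ N ≤ K`, `0 ≤ σ`, `s ≠ 1`, `0 ≤ M0`, `|s|² ≤ M0²`, and the engine
accepts `n^{-σ}` for `n ≤ N`. [folklore] -/
def check (logs : List FI) (K : ℕ) : Bool :=
  decide (1 ≤ nd.N) && decide (nd.N ≤ K) && decide (0 ≤ nd.σ) &&
    !(decide (nd.σ = 1) && decide (nd.t = 0)) && decide (0 ≤ nd.M0) &&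
    decide (nd.σ ^ 2 + nd.t ^ 2 ≤ nd.M0 ^ 2) && powNegRangeOK logs nd.σ nd.N

section basic

variable {nd} {logs : List FI} {K : ℕ}

/-- A checked node has `N ≥ 1`. [folklore] -/
lemma one_le_N (h : nd.check logs K = true) : 1 ≤ nd.N := by
  simp only [check, Bool.and_eq_true, decide_eq_true_eq] at h; exact h.1.1.1.1.1.1

/-- A checked node has `N ≤ K`. [folklore] -/
lemma N_le (h : nd.check logs K = true) : nd.N ≤ K := by
  simp only [check, Bool.and_eq_true, decide_eq_true_eq] at h; exact h.1.1.1.1.1.2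

/-- A checked node has `σ ≥ 0`. [folklore] -/
lemma σ_nonneg (h : nd.check logs K = true) : 0 ≤ nd.σ := by
  simp only [check, Bool.and_eq_true, decide_eq_true_eq] at h; exact h.1.1.1.1.2

/-- The `n^{-σ}` flags of a checked node. [folklore] -/
lemma powNegOK_of_check (h : nd.check logs K = true) :
    ∀ n, 1 ≤ n → n ≤ nd.N → powNegOK logs nd.σ n = true := by
  simp only [check, Bool.and_eq_true, decide_eq_true_eq] at h
  exact powNegRangeOK_spec h.2

/-- A checked node is not the pole `s = 1`. [folklore] -/
lemma s_ne_one (h : nd.check logs K = true) : nd.s ≠ 1 := by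
  simp only [check, Bool.and_eq_true, decide_eq_true_eq, Bool.not_eq_true',
    Bool.and_eq_false_iff, decide_eq_false_iff_not] at h
  obtain ⟨⟨⟨⟨-, h2⟩, -⟩, -⟩, -⟩ := h
  intro h1
  have hre := congrArg Complex.re h1
  have him := congrArg Complex.im h1
  simp only [s_re, Complex.one_re, s_im, Complex.one_im] at hre him
  rcases h2 with h2 | h2
  · exact h2 (by exact_mod_cast hre)
  · exact h2 (by exact_mod_cast him)

/-- `Re s > -4` (the Euler–Maclaurin range). [folklore] -/
lemma re_gt (h : nd.check logs K = true) : -4 < nd.s.re := by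
  rw [s_re]; have : (0 : ℝ) ≤ nd.σ := by exact_mod_cast σ_nonneg h
  linarith

/-- `M0 ≥ 0`. [folklore] -/
lemma M0_nonneg (h : nd.check logs K = true) : 0 ≤ nd.M0 := by
  simp only [check, Bool.and_eq_true, decide_eq_true_eq] at h; exact h.1.1.2

/-- `|s| ≤ M0`. [folklore] -/
lemma norm_s_le (h : nd.check logs K = true) : ‖nd.s‖ ≤ nd.M0 := by
  have h0 := M0_nonneg h
  simp only [check, Bool.and_eq_true, decide_eq_true_eq] at h
  have h2 : ((nd.σ ^ 2 + nd.t ^ 2 : ℚ) : ℝ) ≤ ((nd.M0 ^ 2 : ℚ) : ℝ) := by exact_mod_cast h.1.2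
  push_cast at h2
  have hns : ‖nd.s‖ ^ 2 = (nd.σ : ℝ) ^ 2 + (nd.t : ℝ) ^ 2 := by
    rw [Complex.sq_norm, Complex.normSq_apply, s_re, s_im]; ring
  have h0' : (0 : ℝ) ≤ nd.M0 := by exact_mod_cast h0
  exact (pow_le_pow_iff_left₀ (norm_nonneg _) h0' two_ne_zero).1 (by rw [hns]; exact h2)

end basic

/-- The box of `n^{-s}` (`n ≥ 1`): modulus `n^{-σ}`, phase `-t log n`. [folklore] -/
def termBox (logs : List FI) (n : ℕ) : CB :=
  let θ := FI.mul (FI.ofRat nd.t) (logs.getD n (FI.ofInt 0))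
  let cs := FI.cosSin θ
  let w := powNeg logs nd.σ n
  ⟨FI.mul w cs.1, FI.neg (FI.mul w cs.2)⟩

/-- `n^{-s} = n^{-σ}(cos(t log n) - i sin(t log n))`. [folklore] -/
lemma cpow_neg_eq {n : ℕ} (hn : 1 ≤ n) :
    (n : ℂ) ^ (-nd.s) = ((rpowNeg nd.σ n * Real.cos (nd.t * Real.log n) : ℝ) : ℂ) +
      ((-(rpowNeg nd.σ n * Real.sin (nd.t * Real.log n)) : ℝ) : ℂ) * I := by
  have hn0 : (n : ℂ) ≠ 0 := by exact_mod_cast (show n ≠ 0 by omega)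
  rw [Complex.cpow_def_of_ne_zero hn0, ← Complex.natCast_log]
  have hre : ((Real.log n : ℂ) * -nd.s).re = -((nd.σ : ℝ) * Real.log n) := by
    rw [Complex.re_ofReal_mul, Complex.neg_re, s_re]; ring
  have him : ((Real.log n : ℂ) * -nd.s).im = -(nd.t * Real.log n) := by
    rw [Complex.im_ofReal_mul, Complex.neg_im, s_im]; ring
  apply Complex.ext
  · rw [Complex.exp_re, hre, him, Real.cos_neg]
    simp only [rpowNeg, Complex.add_re, Complex.ofReal_re, Complex.mul_re, Complex.I_re,
      Complex.I_im, Complex.ofReal_im, mul_zero, mul_one, sub_zero, add_zero]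
  · rw [Complex.exp_im, hre, him, Real.sin_neg]
    simp only [rpowNeg, Complex.add_im, Complex.ofReal_im, Complex.mul_im, Complex.I_re,
      Complex.I_im, Complex.ofReal_re, mul_zero, mul_one, zero_add, add_zero, mul_neg]

variable {logs : List FI} {K : ℕ}

/-- **`n^{-s} ∈ termBox`.** [folklore] -/
lemma mem_termBox (hl : LogsValid logs K) (h : nd.check logs K = true) {n : ℕ} (hn : 1 ≤ n)
    (hnN : n ≤ nd.N) : CB.mem ((n : ℂ) ^ (-nd.s)) (nd.termBox logs n) := by
  have hnK : n ≤ K := hnN.trans (N_le h)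
  have hθ : FI.mem ((nd.t : ℝ) * Real.log n)
      (FI.mul (FI.ofRat nd.t) (logs.getD n (FI.ofInt 0))) :=
    FI.mem_mul (FI.mem_ofRat _) (hl n hnK)
  have hcs := FI.mem_cosSin hθ
  have hw : FI.mem (rpowNeg nd.σ n) (powNeg logs nd.σ n) :=
    mem_powNeg hl hnK (powNegOK_of_check h n hn hnN)
  rw [cpow_neg_eq nd hn]
  refine ⟨?_, ?_⟩
  · show FI.mem _ (FI.mul (powNeg logs nd.σ n) (FI.cosSin _).1)
    simp only [Complex.add_re, Complex.ofReal_re, Complex.mul_re, Complex.I_re, mul_zero,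
      Complex.ofReal_im, Complex.I_im, sub_zero, add_zero, zero_mul]
    simpa using FI.mem_mul hw hcs.1
  · show FI.mem _ (FI.neg (FI.mul (powNeg logs nd.σ n) (FI.cosSin _).2))
    simp only [Complex.add_im, Complex.ofReal_im, Complex.mul_im, Complex.I_re, mul_zero,
      Complex.ofReal_re, Complex.I_im, mul_one, zero_add, add_zero]
    exact FI.mem_neg (FI.mem_mul hw hcs.2)

/-- `Σ_{n=1}^{m} n^{-s}` as a box. [folklore] -/
def sumBox (logs : List FI) : ℕ → CB
  | 0 => CB.ofInt 0
  | m + 1 => (sumBox logs m).add (nd.termBox logs (m + 1))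

/-- `Σ_{n=1}^{m} (log n) n^{-s}` as a box. [folklore] -/
def sum1Box (logs : List FI) : ℕ → CB
  | 0 => CB.ofInt 0
  | m + 1 => (sum1Box logs m).add
      ((nd.termBox logs (m + 1)).mulFI (logs.getD (m + 1) (FI.ofInt 0)))

/-- `Σ_{n ≤ m} n^{-s} ∈ sumBox m`. [folklore] -/
lemma mem_sumBox (hl : LogsValid logs K) (h : nd.check logs K = true) :
    ∀ m ≤ nd.N, CB.mem (∑ n ∈ Finset.Ico 1 (m + 1), (n : ℂ) ^ (-nd.s)) (nd.sumBox logs m)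
  | 0, _ => by simpa [sumBox] using CB.mem_zero
  | m + 1, hm => by
    rw [Finset.sum_Ico_succ_top (by omega), sumBox]
    exact CB.mem_add (mem_sumBox hl h m (by omega)) (nd.mem_termBox hl h (by omega) hm)

/-- `Σ_{n ≤ m} (log n) n^{-s} ∈ sum1Box m`. [folklore] -/
lemma mem_sum1Box (hl : LogsValid logs K) (h : nd.check logs K = true) :
    ∀ m ≤ nd.N, CB.mem (∑ n ∈ Finset.Ico 1 (m + 1), (Real.log n : ℂ) * (n : ℂ) ^ (-nd.s))
      (nd.sum1Box logs m)
  | 0, _ => by simpa [sum1Box] using CB.mem_zero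
  | m + 1, hm => by
    rw [Finset.sum_Ico_succ_top (by omega), sum1Box]
    refine CB.mem_add (mem_sum1Box hl h m (by omega)) ?_
    rw [mul_comm]
    exact CB.mem_mulFI (nd.mem_termBox hl h (by omega) hm) (hl _ (hm.trans (N_le h)))

/-- Upper bound `W ≥ N^{-σ}` used in the remainder estimates. [folklore] -/
def wHi (logs : List FI) : ℚ := (powNeg logs nd.σ nd.N).hiQ

/-- `P0 = M0(M0+1)(M0+2)(M0+3)(M0+4) ≥ |(s)₅|`. [folklore] -/
def P0 : ℚ := nd.M0 * (nd.M0 + 1) * (nd.M0 + 2) * (nd.M0 + 3) * (nd.M0 + 4)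

/-- `P1 = 5M0⁴ + 40M0³ + 105M0² + 100M0 + 24 ≥ |(s)₅'|` (`= dP0/dM0`). [folklore] -/
def P1 : ℚ := 5 * nd.M0 ^ 4 + 40 * nd.M0 ^ 3 + 105 * nd.M0 ^ 2 + 100 * nd.M0 + 24

/-- Bound for `|R₄(s)|` (cf. `Literature.NumberTheory.LFunctions.norm_emRem₂_le`). [cite: Edwards1974, §6.4] -/
def rho0 (logs : List FI) : ℚ :=
  nd.P0 / 120 * (7 / 96 * (nd.wHi logs / nd.N ^ 4 / (nd.σ + 4)))

/-- Bound for `|R₄'(s)|` (cf. `Literature.NumberTheory.LFunctions.norm_emRem₂D_le`). [cite: Edwards1974, §6.4] -/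
def rho1 (logs : List FI) : ℚ :=
  nd.P1 / 120 * (7 / 96 * (nd.wHi logs / nd.N ^ 4 / (nd.σ + 4))) +
    nd.P0 / 120 * (7 / 96 * (nd.wHi logs / nd.N ^ 4 *
      ((logs.getD nd.N (FI.ofInt 0)).hiQ / (nd.σ + 4) + 1 / (nd.σ + 4) ^ 2)))

/-- **The box of `ζ(s)`**: Euler–Maclaurin main term in interval arithmetic, widened by `rho0`.
[cite: Edwards1974, §6.4 eq. (1)] -/
def zetaBox (logs : List FI) : CB :=
  ((nd.sumBox logs (nd.N - 1)).add ((nd.termBox logs nd.N).mul (emAQ nd.N nd.sQ).toCB)).widenQ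
    (nd.rho0 logs)

/-- **The box of `ζ'(s)`**. [cite: Edwards1974, §6.4 eq. (1)] -/
def zeta1Box (logs : List FI) : CB :=
  (((nd.sum1Box logs (nd.N - 1)).neg).add ((nd.termBox logs nd.N).mul
    (((emA₁Q nd.N nd.sQ).toCB).sub
      ((emAQ nd.N nd.sQ).toCB.mulFI (logs.getD nd.N (FI.ofInt 0)))))).widenQ
    (nd.rho1 logs)

/-- `|z + k| ≤ |z| + k`. [folklore] -/
lemma norm_add_nat_le {z : ℂ} {M : ℝ} (h : ‖z‖ ≤ M) (k : ℕ) : ‖z + k‖ ≤ M + k :=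
  (norm_add_le _ _).trans (by simp [h])

/-- `|(s)₅| ≤ M(M+1)(M+2)(M+3)(M+4)` for `|s| ≤ M`. [folklore] -/
lemma norm_poch5_le {z : ℂ} {M : ℝ} (hM : 0 ≤ M) (h : ‖z‖ ≤ M) :
    ‖Literature.NumberTheory.LFunctions.poch5 z‖ ≤ M * (M + 1) * (M + 2) * (M + 3) * (M + 4) := by
  unfold Literature.NumberTheory.LFunctions.poch5
  simp only [norm_mul]
  have h1 := norm_add_nat_le h 1; have h2 := norm_add_nat_le h 2
  have h3 := norm_add_nat_le h 3; have h4 := norm_add_nat_le h 4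
  push_cast at h1 h2 h3 h4
  gcongr

/-- `|(s)₅'| ≤ 5M⁴ + 40M³ + 105M² + 100M + 24` for `|s| ≤ M`. [folklore] -/
lemma norm_poch5₁_le {z : ℂ} {M : ℝ} (_hM : 0 ≤ M) (h : ‖z‖ ≤ M) :
    ‖Literature.NumberTheory.LFunctions.poch5₁ z‖ ≤ 5 * M ^ 4 + 40 * M ^ 3 + 105 * M ^ 2 + 100 * M + 24 := by
  unfold Literature.NumberTheory.LFunctions.poch5₁
  have e4 : ‖z ^ 4‖ ≤ M ^ 4 := by rw [norm_pow]; gcongr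
  have e3 : ‖z ^ 3‖ ≤ M ^ 3 := by rw [norm_pow]; gcongr
  have e2 : ‖z ^ 2‖ ≤ M ^ 2 := by rw [norm_pow]; gcongr
  calc ‖5 * z ^ 4 + 40 * z ^ 3 + 105 * z ^ 2 + 100 * z + 24‖
      ≤ ‖5 * z ^ 4‖ + ‖40 * z ^ 3‖ + ‖105 * z ^ 2‖ + ‖100 * z‖ + ‖(24 : ℂ)‖ := by
        refine (norm_add_le _ _).trans (add_le_add ((norm_add_le _ _).trans (add_le_add
          ((norm_add_le _ _).trans (add_le_add ((norm_add_le _ _).trans le_rfl) le_rfl)) le_rfl))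
          le_rfl)
    _ ≤ 5 * M ^ 4 + 40 * M ^ 3 + 105 * M ^ 2 + 100 * M + 24 := by
        simp only [norm_mul, Complex.norm_ofNat]
        gcongr

/-- `|(s)₅''| ≤ 20M³ + 120M² + 210M + 100` for `|s| ≤ M`. [folklore] -/
lemma norm_poch5₂_le {z : ℂ} {M : ℝ} (_hM : 0 ≤ M) (h : ‖z‖ ≤ M) :
    ‖Literature.NumberTheory.LFunctions.poch5₂ z‖ ≤ 20 * M ^ 3 + 120 * M ^ 2 + 210 * M + 100 := by
  unfold Literature.NumberTheory.LFunctions.poch5₂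
  have e3 : ‖z ^ 3‖ ≤ M ^ 3 := by rw [norm_pow]; gcongr
  have e2 : ‖z ^ 2‖ ≤ M ^ 2 := by rw [norm_pow]; gcongr
  calc ‖20 * z ^ 3 + 120 * z ^ 2 + 210 * z + 100‖
      ≤ ‖20 * z ^ 3‖ + ‖120 * z ^ 2‖ + ‖210 * z‖ + ‖(100 : ℂ)‖ := by
        refine (norm_add_le _ _).trans (add_le_add ((norm_add_le _ _).trans (add_le_add
          ((norm_add_le _ _).trans le_rfl) le_rfl)) le_rfl)
    _ ≤ 20 * M ^ 3 + 120 * M ^ 2 + 210 * M + 100 := by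
        simp only [norm_mul, Complex.norm_ofNat]
        gcongr

/-- `N^{-(σ+4)} = N^{-σ} / N^4`. [folklore] -/
lemma rpow_neg_re_add_four {N : ℕ} (hN : 1 ≤ N) :
    (N : ℝ) ^ (-(nd.s.re + 4)) = rpowNeg nd.σ N / (N : ℝ) ^ 4 := by
  have hN' : (0 : ℝ) < N := by exact_mod_cast (show 0 < N by omega)
  rw [Real.rpow_def_of_pos hN', s_re, show Real.log N * -((nd.σ : ℝ) + 4) =
    -((nd.σ : ℝ) * Real.log N) + -(4 * Real.log N) by ring, Real.exp_add, rpowNeg,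
    Real.exp_neg (4 * Real.log N), show (4 : ℝ) * Real.log N = ((4 : ℕ) : ℝ) * Real.log N by norm_num,
    Real.exp_nat_mul, Real.exp_log hN', div_eq_mul_inv]

/-- `N^{-σ} ≤ wHi`. [folklore] -/
lemma rpowNeg_le_wHi (hl : LogsValid logs K) (h : nd.check logs K = true) :
    rpowNeg nd.σ nd.N ≤ nd.wHi logs :=
  FI.le_hiQ (mem_powNeg hl (N_le h) (powNegOK_of_check h _ (one_le_N h) le_rfl))

/-- `log N ≤` the table's upper end point. [folklore] -/
lemma log_le_hiQ (hl : LogsValid logs K) (h : nd.check logs K = true) :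
    Real.log nd.N ≤ (logs.getD nd.N (FI.ofInt 0)).hiQ :=
  FI.le_hiQ (hl _ (N_le h))

/-- `M(M+1)(M+2)(M+3)(M+4) ≥ 0` for `M ≥ 0`. [folklore] -/
lemma P0_nonneg_real {M : ℝ} (hM : 0 ≤ M) : 0 ≤ M * (M + 1) * (M + 2) * (M + 3) * (M + 4) :=
  mul_nonneg (mul_nonneg (mul_nonneg (mul_nonneg hM (by linarith)) (by linarith)) (by linarith))
    (by linarith)

/-- `|R₄(s)| ≤ rho0`. [cite: Edwards1974, §6.4] -/
lemma norm_emRem₂_le_rho0 (hl : LogsValid logs K) (h : nd.check logs K = true) :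
    ‖Literature.NumberTheory.LFunctions.emRem₂ nd.N nd.s‖ ≤ nd.rho0 logs := by
  have hN := one_le_N h
  have hb := Literature.NumberTheory.LFunctions.norm_emRem₂_le hN (re_gt h) (s := nd.s)
  refine hb.trans ?_
  have hM0 : (0 : ℝ) ≤ nd.M0 := by exact_mod_cast M0_nonneg h
  have hσ0 : (0 : ℝ) ≤ nd.σ := by exact_mod_cast σ_nonneg h
  have hP := norm_poch5_le hM0 (norm_s_le h)
  have hP0 := P0_nonneg_real hM0
  have hW := nd.rpowNeg_le_wHi hl h
  have hN' : (0 : ℝ) < nd.N := by exact_mod_cast (show 0 < nd.N by omega)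
  have hN4 : (0 : ℝ) < (nd.N : ℝ) ^ 4 := by positivity
  rw [rpow_neg_re_add_four nd hN, s_re]
  simp only [rho0, P0]
  push_cast
  have hr : (0 : ℝ) ≤ rpowNeg nd.σ nd.N := (rpowNeg_pos _ _).le
  have ha : (0 : ℝ) < (nd.σ : ℝ) + 4 := by linarith
  have hX : (0 : ℝ) ≤ 7 / 96 * (rpowNeg nd.σ nd.N / (nd.N : ℝ) ^ 4 / ((nd.σ : ℝ) + 4)) :=
    mul_nonneg (by norm_num) (div_nonneg (div_nonneg hr hN4.le) ha.le)
  calc ‖Literature.NumberTheory.LFunctions.poch5 nd.s‖ / 120 * (7 / 96 * (rpowNeg nd.σ nd.N / (nd.N : ℝ) ^ 4 /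
        ((nd.σ : ℝ) + 4)))
      ≤ nd.M0 * (nd.M0 + 1) * (nd.M0 + 2) * (nd.M0 + 3) * (nd.M0 + 4) / 120 *
        (7 / 96 * (rpowNeg nd.σ nd.N / (nd.N : ℝ) ^ 4 / ((nd.σ : ℝ) + 4))) :=
        mul_le_mul_of_nonneg_right (div_le_div_of_nonneg_right hP (by norm_num)) hX
    _ ≤ nd.M0 * (nd.M0 + 1) * (nd.M0 + 2) * (nd.M0 + 3) * (nd.M0 + 4) / 120 *
        (7 / 96 * (((nd.wHi logs : ℚ) : ℝ) / (nd.N : ℝ) ^ 4 / ((nd.σ : ℝ) + 4))) := by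
        refine mul_le_mul_of_nonneg_left (mul_le_mul_of_nonneg_left ?_ (by norm_num))
          (div_nonneg hP0 (by norm_num))
        exact div_le_div_of_nonneg_right (div_le_div_of_nonneg_right hW hN4.le) ha.le

/-- `|R₄'(s)| ≤ rho1`. [cite: Edwards1974, §6.4] -/
lemma norm_emRem₂D_le_rho1 (hl : LogsValid logs K) (h : nd.check logs K = true) :
    ‖Literature.NumberTheory.LFunctions.emRem₂D nd.N nd.s‖ ≤ nd.rho1 logs := by
  have hN := one_le_N h
  have hb := Literature.NumberTheory.LFunctions.norm_emRem₂D_le hN (re_gt h) (s := nd.s)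
  refine hb.trans ?_
  have hM0 : (0 : ℝ) ≤ nd.M0 := by exact_mod_cast M0_nonneg h
  have hσ0 : (0 : ℝ) ≤ nd.σ := by exact_mod_cast σ_nonneg h
  have hP := norm_poch5_le hM0 (norm_s_le h)
  have hP0 := P0_nonneg_real hM0
  have hP1 := norm_poch5₁_le hM0 (norm_s_le h)
  have hP10 : (0 : ℝ) ≤ 5 * nd.M0 ^ 4 + 40 * nd.M0 ^ 3 + 105 * nd.M0 ^ 2 + 100 * nd.M0 + 24 := by
    have h2 := pow_nonneg hM0 2; have h3 := pow_nonneg hM0 3; have h4 := pow_nonneg hM0 4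
    linarith
  have hW := nd.rpowNeg_le_wHi hl h
  have hL := nd.log_le_hiQ hl h
  have hN' : (0 : ℝ) < nd.N := by exact_mod_cast (show 0 < nd.N by omega)
  have hN4 : (0 : ℝ) < (nd.N : ℝ) ^ 4 := by positivity
  have hlog : 0 ≤ Real.log nd.N := Real.log_natCast_nonneg _
  rw [rpow_neg_re_add_four nd hN, s_re]
  simp only [rho1, P0, P1]
  push_cast
  have hr : (0 : ℝ) ≤ rpowNeg nd.σ nd.N := (rpowNeg_pos _ _).le
  have ha : (0 : ℝ) < (nd.σ : ℝ) + 4 := by linarith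
  set r := rpowNeg nd.σ nd.N with hrdef
  set W : ℝ := ((nd.wHi logs : ℚ) : ℝ) with hWdef
  set L : ℝ := (((logs.getD nd.N (FI.ofInt 0)).hiQ : ℚ) : ℝ) with hLdef
  set a : ℝ := (nd.σ : ℝ) + 4 with hadef
  set P : ℝ := nd.M0 * (nd.M0 + 1) * (nd.M0 + 2) * (nd.M0 + 3) * (nd.M0 + 4) with hPdef
  set Q : ℝ := 5 * nd.M0 ^ 4 + 40 * nd.M0 ^ 3 + 105 * nd.M0 ^ 2 + 100 * nd.M0 + 24 with hQdef
  set V : ℝ := (nd.N : ℝ) ^ 4 with hVdef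
  have hLa : Real.log nd.N / a + 1 / a ^ 2 ≤ L / a + 1 / a ^ 2 :=
    add_le_add_left (div_le_div_of_nonneg_right hL ha.le) _
  have hla0 : 0 ≤ Real.log nd.N / a + 1 / a ^ 2 := by positivity
  have h1 : ‖Literature.NumberTheory.LFunctions.poch5₁ nd.s‖ / 120 * (7 / 96 * (r / V / a)) ≤ Q / 120 * (7 / 96 * (W / V / a)) :=
    calc ‖Literature.NumberTheory.LFunctions.poch5₁ nd.s‖ / 120 * (7 / 96 * (r / V / a))
        ≤ Q / 120 * (7 / 96 * (r / V / a)) :=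
          mul_le_mul_of_nonneg_right (div_le_div_of_nonneg_right hP1 (by norm_num))
            (mul_nonneg (by norm_num) (div_nonneg (div_nonneg hr hN4.le) ha.le))
      _ ≤ Q / 120 * (7 / 96 * (W / V / a)) :=
          mul_le_mul_of_nonneg_left (mul_le_mul_of_nonneg_left
            (div_le_div_of_nonneg_right (div_le_div_of_nonneg_right hW hN4.le) ha.le)
            (by norm_num)) (div_nonneg hP10 (by norm_num))
  have h2 : ‖Literature.NumberTheory.LFunctions.poch5 nd.s‖ / 120 * (7 / 96 * (r / V * (Real.log nd.N / a + 1 / a ^ 2))) ≤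
      P / 120 * (7 / 96 * (W / V * (L / a + 1 / a ^ 2))) :=
    calc ‖Literature.NumberTheory.LFunctions.poch5 nd.s‖ / 120 * (7 / 96 * (r / V * (Real.log nd.N / a + 1 / a ^ 2)))
        ≤ P / 120 * (7 / 96 * (r / V * (Real.log nd.N / a + 1 / a ^ 2))) :=
          mul_le_mul_of_nonneg_right (div_le_div_of_nonneg_right hP (by norm_num))
            (mul_nonneg (by norm_num) (mul_nonneg (div_nonneg hr hN4.le) hla0))
      _ ≤ P / 120 * (7 / 96 * (W / V * (L / a + 1 / a ^ 2))) :=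
          mul_le_mul_of_nonneg_left (mul_le_mul_of_nonneg_left
            (mul_le_mul (div_le_div_of_nonneg_right hW hN4.le) hLa hla0
              (div_nonneg (hr.trans hW) hN4.le)) (by norm_num))
            (div_nonneg hP0 (by norm_num))
  exact add_le_add h1 h2

/-- **`ζ(s) ∈ zetaBox`.** [cite: Edwards1974, §6.4 eq. (1)] -/
theorem mem_zetaBox (hl : LogsValid logs K) (h : nd.check logs K = true) :
    CB.mem (riemannZeta nd.s) (nd.zetaBox logs) := by
  have hN := one_le_N h
  have hmain : CB.mem (Literature.NumberTheory.LFunctions.emMain nd.N nd.s)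
      ((nd.sumBox logs (nd.N - 1)).add ((nd.termBox logs nd.N).mul (emAQ nd.N nd.sQ).toCB)) := by
    unfold Literature.NumberTheory.LFunctions.emMain
    refine CB.mem_add ?_ (CB.mem_mul (nd.mem_termBox hl h hN le_rfl) ?_)
    · have := nd.mem_sumBox hl h (nd.N - 1) (by omega)
      rwa [Nat.sub_add_cancel hN] at this
    · rw [← show (emAQ nd.N nd.sQ).toC = Literature.NumberTheory.LFunctions.emA nd.N nd.s from toC_emAQ _ _]
      exact QC.mem_toCB _
  unfold zetaBox
  refine CB.mem_widenQ hmain ?_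
  rw [Literature.NumberTheory.LFunctions.riemannZeta_eq_emMain_add_emRem₂ hN (re_gt h) (s_ne_one h), add_sub_cancel_left]
  exact nd.norm_emRem₂_le_rho0 hl h

/-- **`ζ'(s) ∈ zeta1Box`.** [cite: Edwards1974, §6.4 eq. (1)] -/
theorem mem_zeta1Box (hl : LogsValid logs K) (h : nd.check logs K = true) :
    CB.mem (deriv riemannZeta nd.s) (nd.zeta1Box logs) := by
  have hN := one_le_N h
  have hmain : CB.mem (Literature.NumberTheory.LFunctions.emMain₁ nd.N nd.s)
      (((nd.sum1Box logs (nd.N - 1)).neg).add ((nd.termBox logs nd.N).mul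
        (((emA₁Q nd.N nd.sQ).toCB).sub
          ((emAQ nd.N nd.sQ).toCB.mulFI (logs.getD nd.N (FI.ofInt 0)))))) := by
    unfold Literature.NumberTheory.LFunctions.emMain₁
    refine CB.mem_add ?_ (CB.mem_mul (nd.mem_termBox hl h hN le_rfl) (CB.mem_sub ?_ ?_))
    · have := nd.mem_sum1Box hl h (nd.N - 1) (by omega)
      rw [Nat.sub_add_cancel hN] at this
      exact CB.mem_neg this
    · rw [← show (emA₁Q nd.N nd.sQ).toC = Literature.NumberTheory.LFunctions.emA₁ nd.N nd.s from toC_emA₁Q _ _]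
      exact QC.mem_toCB _
    · rw [mul_comm, ← show (emAQ nd.N nd.sQ).toC = Literature.NumberTheory.LFunctions.emA nd.N nd.s from toC_emAQ _ _]
      exact CB.mem_mulFI (QC.mem_toCB _) (hl _ (N_le h))
  unfold zeta1Box
  refine CB.mem_widenQ hmain ?_
  rw [Literature.NumberTheory.LFunctions.deriv_riemannZeta_eq_eulerMaclaurin₂ hN (re_gt h) (s_ne_one h),
    add_sub_cancel_left]
  exact nd.norm_emRem₂D_le_rho1 hl h

end Node

/-! ### A second-order Taylor estimate along a segment -/

/-- If `f` is analytic at every point of the segment `c + u d`, `0 ≤ u ≤ L` (`|d| = 1`), and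
`|f''| ≤ M` there, then `|f(c + u d) - f(c) - f'(c) u d| ≤ M u²/2`. [folklore] -/
theorem norm_sub_taylor_le {f : ℂ → ℂ} {c d : ℂ} (hd : ‖d‖ = 1) {L M : ℝ}
    (hf : ∀ u ∈ Icc (0 : ℝ) L, AnalyticAt ℂ f (c + u * d))
    (hM : ∀ u ∈ Icc (0 : ℝ) L, ‖deriv (deriv f) (c + u * d)‖ ≤ M) :
    ∀ u ∈ Icc (0 : ℝ) L, ‖f (c + u * d) - f c - deriv f c * (u * d)‖ ≤ M * u ^ 2 / 2 := by
  -- the derivative of `u ↦ g (c + u d)` for a function `g` differentiable at `c + u d`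
  have hchain : ∀ {g : ℂ → ℂ} {u : ℝ}, DifferentiableAt ℂ g (c + u * d) →
      HasDerivAt (fun v : ℝ ↦ g (c + v * d)) (deriv g (c + u * d) * d) u := by
    intro g u hg
    have h1 : HasDerivAt (fun w : ℂ ↦ c + w * d) (1 * d) (u : ℂ) :=
      ((hasDerivAt_id (u : ℂ)).mul_const d).const_add c
    have h2 : HasDerivAt (fun w : ℂ ↦ g (c + w * d)) (deriv g (c + u * d) * (1 * d)) (u : ℂ) :=
      HasDerivAt.comp (u : ℂ) hg.hasDerivAt h1
    rw [one_mul] at h2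
    exact h2.comp_ofReal
  set ψ : ℝ → ℂ := fun u ↦ deriv f (c + u * d) with hψ
  -- step 1: `|f'(c+ud) - f'(c)| ≤ M u`
  have hψ' : ∀ u ∈ Icc (0 : ℝ) L,
      HasDerivAt ψ (deriv (deriv f) (c + u * d) * d) u := fun u hu ↦
    hchain (hf u hu).deriv.differentiableAt
  have step1 : ∀ u ∈ Icc (0 : ℝ) L, ‖ψ u - ψ 0‖ ≤ M * u := by
    intro u hu
    have := norm_image_sub_le_of_norm_deriv_le_segment' (f := ψ) (a := 0) (b := L) (C := M)
      (fun x hx ↦ (hψ' x hx).hasDerivWithinAt) (fun x hx ↦ ?_) u hu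
    · simpa using this
    · rw [norm_mul, hd, mul_one]; exact hM x (Ico_subset_Icc_self hx)
  -- step 2: integrate once more
  set g : ℝ → ℂ := fun u ↦ f (c + u * d) - f c - deriv f c * (u * d) with hg
  have hg' : ∀ u ∈ Icc (0 : ℝ) L, HasDerivAt g ((ψ u - ψ 0) * d) u := by
    intro u hu
    have h1 : HasDerivAt (fun v : ℝ ↦ f (c + v * d)) (deriv f (c + u * d) * d) u :=
      hchain (hf u hu).differentiableAt
    have h2 : HasDerivAt (fun v : ℝ ↦ deriv f c * ((v : ℂ) * d)) (deriv f c * (1 * d)) u := by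
      have : HasDerivAt (fun v : ℝ ↦ (v : ℂ) * d) (1 * d) u :=
        ((hasDerivAt_id (u : ℂ)).mul_const d).comp_ofReal
      exact this.const_mul _
    have h3 := (h1.sub_const (f c)).sub h2
    refine h3.congr_deriv ?_
    simp only [hψ, Complex.ofReal_zero, zero_mul, add_zero, one_mul]
    ring
  have hB : ∀ x : ℝ, HasDerivAt (fun u : ℝ ↦ M * u ^ 2 / 2) (M * x) x := by
    intro x
    have h := ((hasDerivAt_id x).mul (hasDerivAt_id x)).const_mul (M / 2)
    have e1 : (fun u : ℝ ↦ M * u ^ 2 / 2) = fun y ↦ M / 2 * (id y * id y) := by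
      funext u; simp only [id]; ring
    rw [e1, show M * x = M / 2 * (1 * id x + id x * 1) by simp only [id]; ring]
    exact h
  have key := image_norm_le_of_norm_deriv_right_le_deriv_boundary (f := g)
    (f' := fun u ↦ (ψ u - ψ 0) * d) (a := 0) (b := L) (B := fun u ↦ M * u ^ 2 / 2)
    (B' := fun u ↦ M * u)
    (fun x hx ↦ (hg' x hx).continuousAt.continuousWithinAt)
    (fun x hx ↦ (hg' x (Ico_subset_Icc_self hx)).hasDerivWithinAt)
    (by simp [hg]) hB
    (fun x hx ↦ by
      rw [norm_mul, hd, mul_one]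
      exact step1 x (Ico_subset_Icc_self hx))
  intro u hu
  exact key hu

/-! ### A crude bound for `|ζ''|` on a region -/

/-- `Σ_{n=1}^{m} (log n)²⁺ (n^{-σ₀})⁺` from the tables (upper end points). [folklore] -/
def sumL2W (logs : List FI) (σ₀ : ℚ) : ℕ → ℚ
  | 0 => 0
  | m + 1 => sumL2W logs σ₀ m +
      (logs.getD (m + 1) (FI.ofInt 0)).hiQ ^ 2 * (powNeg logs σ₀ (m + 1)).hiQ

/-- **The bound `M2 ≥ sup |ζ''(s)|`** over all `s` with `Re s ≥ σ₀`, `|s| ≤ M0`, `|s - 1| ≥ m1`,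
from `ζ'' = M'' + R₄''` with cut-off `N` and termwise estimates. [cite: Edwards1974, §6.4] -/
def M2bound (logs : List FI) (N : ℕ) (σ₀ M0 m1 : ℚ) : ℚ :=
  let L := (logs.getD N (FI.ofInt 0)).hiQ
  let W := (powNeg logs σ₀ N).hiQ
  let A0 := N / m1 + 1 / 2 + M0 / (12 * N) + M0 * (M0 + 1) * (M0 + 2) / (720 * N ^ 3)
  let A1 := N / m1 ^ 2 + 1 / (12 * N) + (3 * M0 ^ 2 + 6 * M0 + 2) / (720 * N ^ 3)
  let A2 := 2 * N / m1 ^ 3 + (6 * M0 + 6) / (720 * N ^ 3)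
  let a0 := σ₀ + 4
  let P0 := M0 * (M0 + 1) * (M0 + 2) * (M0 + 3) * (M0 + 4)
  let P1 := 5 * M0 ^ 4 + 40 * M0 ^ 3 + 105 * M0 ^ 2 + 100 * M0 + 24
  let P2 := 20 * M0 ^ 3 + 120 * M0 ^ 2 + 210 * M0 + 100
  sumL2W logs σ₀ (N - 1) + W * (A2 + 2 * L * A1 + L ^ 2 * A0) +
    (P2 / 120 * (7 / 96 * (W / N ^ 4 / a0)) +
      2 * (P1 / 120) * (7 / 96 * (W / N ^ 4 * (L / a0 + 1 / a0 ^ 2))) +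
      P0 / 120 * (7 / 96 * (W / N ^ 4 * (L ^ 2 / a0 + 2 * L / a0 ^ 2 + 2 / a0 ^ 3))))

section M2

variable {logs : List FI} {K : ℕ} {σ₀ : ℚ}

/-- `|n^{-s}| ≤ W_n` for `Re s ≥ σ₀`. [folklore] -/
lemma norm_cpow_neg_le (hl : LogsValid logs K) {n : ℕ} (hn : 1 ≤ n) (hnK : n ≤ K)
    (hok : powNegOK logs σ₀ n = true) {s : ℂ} (hσ : (σ₀ : ℝ) ≤ s.re) :
    ‖(n : ℂ) ^ (-s)‖ ≤ (powNeg logs σ₀ n).hiQ := by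
  have hn' : (1 : ℝ) ≤ n := by exact_mod_cast hn
  rw [Complex.norm_natCast_cpow_of_pos (by omega), Complex.neg_re]
  calc (n : ℝ) ^ (-s.re) ≤ (n : ℝ) ^ (-(σ₀ : ℝ)) :=
        Real.rpow_le_rpow_of_exponent_le hn' (by linarith)
    _ = rpowNeg σ₀ n := rpow_neg_eq_rpowNeg hn σ₀
    _ ≤ _ := FI.le_hiQ (mem_powNeg hl hnK hok)

/-- `log² n ≤` the square of the table's upper end point. [folklore] -/
lemma log_sq_le (hl : LogsValid logs K) {n : ℕ} (hnK : n ≤ K) :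
    Real.log n ^ 2 ≤ ((logs.getD n (FI.ofInt 0)).hiQ : ℝ) ^ 2 :=
  pow_le_pow_left₀ (Real.log_natCast_nonneg n) (FI.le_hiQ (hl n hnK)) 2

/-- `|Σ_{n ≤ m} log² n · n^{-s}| ≤ sumL2W m` for `Re s ≥ σ₀`. [folklore] -/
lemma norm_sum_log_sq_cpow_le (hl : LogsValid logs K) {s : ℂ} (hσ : (σ₀ : ℝ) ≤ s.re) {M : ℕ}
    (hMK : M ≤ K) (hok : ∀ n, 1 ≤ n → n ≤ M → powNegOK logs σ₀ n = true) :
    ∀ m ≤ M, ‖∑ n ∈ Finset.Ico 1 (m + 1), (Real.log n : ℂ) ^ 2 * (n : ℂ) ^ (-s)‖ ≤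
      sumL2W logs σ₀ m
  | 0, _ => by simp [sumL2W]
  | m + 1, hm => by
    rw [Finset.sum_Ico_succ_top (by omega), sumL2W]
    simp only [Rat.cast_add, Rat.cast_mul, Rat.cast_pow]
    refine (norm_add_le _ _).trans (add_le_add (norm_sum_log_sq_cpow_le hl hσ hMK hok m (by omega)) ?_)
    rw [norm_mul, norm_pow, Complex.norm_real, Real.norm_eq_abs,
      abs_of_nonneg (Real.log_natCast_nonneg _)]
    exact mul_le_mul (log_sq_le hl (by omega)) (norm_cpow_neg_le hl (by omega) (by omega)
      (hok _ (by omega) hm) hσ) (norm_nonneg _) (sq_nonneg _)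

/-- `|A(s)| ≤ N/m1 + ½ + M0/(12N) + M0(M0+1)(M0+2)/(720N³)`. [cite: Edwards1974, §6.4] -/
lemma norm_emA_le {N : ℕ} (hN : 1 ≤ N) {s : ℂ} {M0 m1 : ℝ} (hm1 : 0 < m1) (hM0 : 0 ≤ M0)
    (hs : ‖s‖ ≤ M0) (hs1 : m1 ≤ ‖s - 1‖) :
    ‖Literature.NumberTheory.LFunctions.emA N s‖ ≤ N / m1 + 1 / 2 + M0 / (12 * N) + M0 * (M0 + 1) * (M0 + 2) / (720 * N ^ 3) := by
  unfold Literature.NumberTheory.LFunctions.emA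
  have hN' : (0 : ℝ) < N := by exact_mod_cast (show 0 < N by omega)
  have h1 := Node.norm_add_nat_le hs 1; have h2 := Node.norm_add_nat_le hs 2
  push_cast at h1 h2
  refine (norm_sub_le _ _).trans ?_
  refine (add_le_add ((norm_add_le _ _).trans (add_le_add ((norm_add_le _ _).trans
    (add_le_add ?_ ?_)) ?_)) ?_)
  · rw [norm_div, Complex.norm_natCast]
    exact div_le_div_of_nonneg_left (by positivity) hm1 hs1
  · simp
  · rw [norm_div, norm_mul, Complex.norm_ofNat, Complex.norm_natCast]
    gcongr
  · rw [norm_div, norm_mul, norm_mul, norm_mul, norm_pow, Complex.norm_ofNat, Complex.norm_natCast]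
    gcongr

/-- `|A'(s)| ≤ N/m1² + 1/(12N) + (3M0²+6M0+2)/(720N³)`. [folklore] -/
lemma norm_emA₁_le {N : ℕ} (hN : 1 ≤ N) {s : ℂ} {M0 m1 : ℝ} (hm1 : 0 < m1) (_hM0 : 0 ≤ M0)
    (hs : ‖s‖ ≤ M0) (hs1 : m1 ≤ ‖s - 1‖) :
    ‖Literature.NumberTheory.LFunctions.emA₁ N s‖ ≤ N / m1 ^ 2 + 1 / (12 * N) + (3 * M0 ^ 2 + 6 * M0 + 2) / (720 * N ^ 3) := by
  unfold Literature.NumberTheory.LFunctions.emA₁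
  have hN' : (0 : ℝ) < N := by exact_mod_cast (show 0 < N by omega)
  refine (norm_sub_le _ _).trans (add_le_add ((norm_add_le _ _).trans (add_le_add ?_ ?_)) ?_)
  · rw [norm_div, norm_neg, Complex.norm_natCast, norm_pow]
    exact div_le_div_of_nonneg_left (by positivity) (by positivity) (pow_le_pow_left₀ hm1.le hs1 2)
  · rw [norm_div, norm_mul, Complex.norm_ofNat, Complex.norm_natCast, norm_one]
  · rw [norm_div, norm_mul, norm_pow, Complex.norm_ofNat, Complex.norm_natCast]
    gcongr
    calc ‖3 * s ^ 2 + 6 * s + 2‖ ≤ ‖3 * s ^ 2‖ + ‖6 * s‖ + ‖(2 : ℂ)‖ :=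
          (norm_add_le _ _).trans (add_le_add ((norm_add_le _ _).trans le_rfl) le_rfl)
      _ ≤ 3 * M0 ^ 2 + 6 * M0 + 2 := by
          simp only [norm_mul, norm_pow, Complex.norm_ofNat]
          gcongr

/-- `|A''(s)| ≤ 2N/m1³ + (6M0+6)/(720N³)`. [folklore] -/
lemma norm_emA₂_le {N : ℕ} (hN : 1 ≤ N) {s : ℂ} {M0 m1 : ℝ} (hm1 : 0 < m1) (_hM0 : 0 ≤ M0)
    (hs : ‖s‖ ≤ M0) (hs1 : m1 ≤ ‖s - 1‖) :
    ‖Literature.NumberTheory.LFunctions.emA₂ N s‖ ≤ 2 * N / m1 ^ 3 + (6 * M0 + 6) / (720 * N ^ 3) := by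
  unfold Literature.NumberTheory.LFunctions.emA₂
  have hN' : (0 : ℝ) < N := by exact_mod_cast (show 0 < N by omega)
  refine (norm_sub_le _ _).trans (add_le_add ?_ ?_)
  · rw [norm_div, norm_mul, Complex.norm_ofNat, Complex.norm_natCast, norm_pow]
    exact div_le_div_of_nonneg_left (by positivity) (by positivity) (pow_le_pow_left₀ hm1.le hs1 3)
  · rw [norm_div, norm_mul, Complex.norm_ofNat, norm_pow, Complex.norm_natCast]
    gcongr
    calc ‖6 * s + 6‖ ≤ ‖6 * s‖ + ‖(6 : ℂ)‖ := norm_add_le _ _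
      _ ≤ 6 * M0 + 6 := by simp only [norm_mul, Complex.norm_ofNat]; gcongr

/-- **Pointwise soundness of `M2bound`.** [cite: Edwards1974, §6.4] -/
theorem norm_deriv2_zeta_le (hl : LogsValid logs K) {N : ℕ} {M0 m1 : ℚ}
    (hN : 1 ≤ N) (hNK : N ≤ K) (hok : ∀ n, 1 ≤ n → n ≤ N → powNegOK logs σ₀ n = true)
    (hσ0 : 0 ≤ σ₀) (hm1 : 0 < m1) (hM0 : 0 ≤ M0) {s : ℂ}
    (hσ : (σ₀ : ℝ) ≤ s.re) (hs : ‖s‖ ≤ M0) (hs1 : (m1 : ℝ) ≤ ‖s - 1‖) :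
    ‖deriv (deriv riemannZeta) s‖ ≤ M2bound logs N σ₀ M0 m1 := by
  have hm1' : (0 : ℝ) < m1 := by exact_mod_cast hm1
  have hM0' : (0 : ℝ) ≤ M0 := by exact_mod_cast hM0
  have hσ0' : (0 : ℝ) ≤ σ₀ := by exact_mod_cast hσ0
  have hs_ne : s ≠ 1 := by
    intro h; rw [h, sub_self, norm_zero] at hs1; linarith
  have hre : -4 < s.re := by linarith
  have hN' : (0 : ℝ) < N := by exact_mod_cast (show 0 < N by omega)
  have hN4 : (0 : ℝ) < (N : ℝ) ^ 4 := by positivity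
  rw [Literature.NumberTheory.LFunctions.deriv2_riemannZeta_eq_eulerMaclaurin₂ hN hre hs_ne]
  -- abbreviations
  set L : ℝ := (((logs.getD N (FI.ofInt 0)).hiQ : ℚ) : ℝ) with hLdef
  set W : ℝ := (((powNeg logs σ₀ N).hiQ : ℚ) : ℝ) with hWdef
  have hL : Real.log N ≤ L := FI.le_hiQ (hl N hNK)
  have hlog0 : 0 ≤ Real.log N := Real.log_natCast_nonneg _
  have hL0 : 0 ≤ L := hlog0.trans hL
  have hWn : ‖(N : ℂ) ^ (-s)‖ ≤ W := norm_cpow_neg_le hl hN hNK (hok N hN le_rfl) hσ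
  have hW0 : 0 ≤ W := (norm_nonneg _).trans hWn
  have hWmem : rpowNeg σ₀ N ≤ W := FI.le_hiQ (mem_powNeg hl hNK (hok N hN le_rfl))
  clear_value L W
  have hA0 := norm_emA_le hN hm1' hM0' hs hs1
  have hA1 := norm_emA₁_le hN hm1' hM0' hs hs1
  have hA2 := norm_emA₂_le hN hm1' hM0' hs hs1
  set A0 : ℝ := N / m1 + 1 / 2 + M0 / (12 * N) + M0 * (M0 + 1) * (M0 + 2) / (720 * N ^ 3)
    with hA0def
  set A1 : ℝ := N / m1 ^ 2 + 1 / (12 * N) + (3 * M0 ^ 2 + 6 * M0 + 2) / (720 * N ^ 3) with hA1def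
  set A2 : ℝ := 2 * N / m1 ^ 3 + (6 * M0 + 6) / (720 * N ^ 3) with hA2def
  -- main term
  have hmain : ‖Literature.NumberTheory.LFunctions.emMain₂ N s‖ ≤
      sumL2W logs σ₀ (N - 1) + W * (A2 + 2 * L * A1 + L ^ 2 * A0) := by
    unfold Literature.NumberTheory.LFunctions.emMain₂
    refine (norm_add_le _ _).trans (add_le_add ?_ ?_)
    · have := norm_sum_log_sq_cpow_le hl hσ hNK hok (N - 1) (by omega)
      rwa [Nat.sub_add_cancel hN] at this
    · rw [norm_mul]
      refine mul_le_mul hWn ?_ (norm_nonneg _) hW0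
      refine (norm_add_le _ _).trans (add_le_add ((norm_sub_le _ _).trans (add_le_add hA2 ?_)) ?_)
      · rw [norm_mul, norm_mul, Complex.norm_ofNat, Complex.norm_real, Real.norm_eq_abs,
          abs_of_nonneg hlog0]
        gcongr
      · rw [norm_mul, norm_pow, Complex.norm_real, Real.norm_eq_abs, abs_of_nonneg hlog0]
        exact mul_le_mul (pow_le_pow_left₀ hlog0 hL 2) hA0 (norm_nonneg _) (sq_nonneg _)
  -- remainder
  have hP := Node.norm_poch5_le hM0' hs
  have hP0 := Node.P0_nonneg_real hM0'
  have hP1 := Node.norm_poch5₁_le hM0' hs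
  have hP2 := Node.norm_poch5₂_le hM0' hs
  have hP10 : (0 : ℝ) ≤ 5 * (M0 : ℝ) ^ 4 + 40 * (M0 : ℝ) ^ 3 + 105 * (M0 : ℝ) ^ 2 + 100 * M0 + 24 := by
    have h2 := pow_nonneg hM0' 2; have h3 := pow_nonneg hM0' 3; have h4 := pow_nonneg hM0' 4
    linarith
  have hP20 : (0 : ℝ) ≤ 20 * (M0 : ℝ) ^ 3 + 120 * (M0 : ℝ) ^ 2 + 210 * M0 + 100 := by
    have h2 := pow_nonneg hM0' 2; have h3 := pow_nonneg hM0' 3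
    linarith
  set a0 : ℝ := (σ₀ : ℝ) + 4 with ha0def
  have ha0 : 0 < a0 := by rw [ha0def]; linarith
  have haa : a0 ≤ s.re + 4 := by rw [ha0def]; linarith
  have ha : 0 < s.re + 4 := ha0.trans_le haa
  -- `N^{-(σ+4)} ≤ W / N^4`
  have hNa : (N : ℝ) ^ (-(s.re + 4)) ≤ W / (N : ℝ) ^ 4 := by
    have hN1 : (1 : ℝ) ≤ N := by exact_mod_cast hN
    calc (N : ℝ) ^ (-(s.re + 4)) ≤ (N : ℝ) ^ (-(σ₀ : ℝ) + (-4 : ℝ)) :=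
          Real.rpow_le_rpow_of_exponent_le hN1 (by linarith)
      _ = rpowNeg σ₀ N / (N : ℝ) ^ 4 := by
          rw [Real.rpow_add hN', rpow_neg_eq_rpowNeg hN, show (-4 : ℝ) = -((4 : ℕ) : ℝ) by norm_num,
            Real.rpow_neg hN'.le, Real.rpow_natCast, div_eq_mul_inv]
      _ ≤ W / (N : ℝ) ^ 4 := div_le_div_of_nonneg_right hWmem hN4.le
  have hinv1 : 1 / (s.re + 4) ≤ 1 / a0 := one_div_le_one_div_of_le ha0 haa
  have hinv2 : 1 / (s.re + 4) ^ 2 ≤ 1 / a0 ^ 2 :=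
    one_div_le_one_div_of_le (by positivity) (pow_le_pow_left₀ ha0.le haa 2)
  have hinv3 : 2 / (s.re + 4) ^ 3 ≤ 2 / a0 ^ 3 :=
    div_le_div_of_nonneg_left (by norm_num) (by positivity) (pow_le_pow_left₀ ha0.le haa 3)
  have hrem : ‖Literature.NumberTheory.LFunctions.emRem₂DD N s‖ ≤
      (20 * (M0 : ℝ) ^ 3 + 120 * (M0 : ℝ) ^ 2 + 210 * M0 + 100) / 120 *
        (7 / 96 * (W / (N : ℝ) ^ 4 / a0)) +
      2 * ((5 * (M0 : ℝ) ^ 4 + 40 * (M0 : ℝ) ^ 3 + 105 * (M0 : ℝ) ^ 2 + 100 * M0 + 24) / 120) *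
        (7 / 96 * (W / (N : ℝ) ^ 4 * (L / a0 + 1 / a0 ^ 2))) +
      (M0 : ℝ) * (M0 + 1) * (M0 + 2) * (M0 + 3) * (M0 + 4) / 120 *
        (7 / 96 * (W / (N : ℝ) ^ 4 * (L ^ 2 / a0 + 2 * L / a0 ^ 2 + 2 / a0 ^ 3))) := by
    refine (Literature.NumberTheory.LFunctions.norm_emRem₂DD_le hN hre).trans ?_
    have e1 : (N : ℝ) ^ (-(s.re + 4)) / (s.re + 4) ≤ W / (N : ℝ) ^ 4 / a0 := by
      rw [div_eq_mul_one_div, div_eq_mul_one_div (W / _)]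
      exact mul_le_mul hNa hinv1 (by positivity) (by positivity)
    have e2 : (N : ℝ) ^ (-(s.re + 4)) * (Real.log N / (s.re + 4) + 1 / (s.re + 4) ^ 2) ≤
        W / (N : ℝ) ^ 4 * (L / a0 + 1 / a0 ^ 2) := by
      refine mul_le_mul hNa (add_le_add ?_ hinv2) (by positivity) (by positivity)
      rw [div_eq_mul_one_div, div_eq_mul_one_div L]
      exact mul_le_mul hL hinv1 (by positivity) hL0
    have e3 : (N : ℝ) ^ (-(s.re + 4)) *
        (Real.log N ^ 2 / (s.re + 4) + 2 * Real.log N / (s.re + 4) ^ 2 + 2 / (s.re + 4) ^ 3) ≤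
        W / (N : ℝ) ^ 4 * (L ^ 2 / a0 + 2 * L / a0 ^ 2 + 2 / a0 ^ 3) := by
      refine mul_le_mul hNa (add_le_add (add_le_add ?_ ?_) hinv3) (by positivity) (by positivity)
      · rw [div_eq_mul_one_div, div_eq_mul_one_div (L ^ 2)]
        exact mul_le_mul (pow_le_pow_left₀ hlog0 hL 2) hinv1 (by positivity) (by positivity)
      · rw [div_eq_mul_one_div, div_eq_mul_one_div (2 * L)]
        exact mul_le_mul (by linarith) hinv2 (by positivity) (by positivity)
    refine add_le_add (add_le_add ?_ ?_) ?_
    · exact mul_le_mul (div_le_div_of_nonneg_right hP2 (by norm_num))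
        (mul_le_mul_of_nonneg_left e1 (by norm_num)) (by positivity) (div_nonneg hP20 (by norm_num))
    · refine mul_le_mul (mul_le_mul_of_nonneg_left (div_le_div_of_nonneg_right hP1 (by norm_num))
        (by norm_num)) (mul_le_mul_of_nonneg_left e2 (by norm_num)) (by positivity) ?_
      exact mul_nonneg (by norm_num) (div_nonneg hP10 (by norm_num))
    · exact mul_le_mul (div_le_div_of_nonneg_right hP (by norm_num))
        (mul_le_mul_of_nonneg_left e3 (by norm_num)) (by positivity) (div_nonneg hP0 (by norm_num))
  have hsum := add_le_add hmain hrem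
  simp only [hA0def, hA1def, hA2def, hLdef, hWdef, ha0def] at hsum
  refine (norm_add_le _ _).trans (hsum.trans_eq ?_)
  simp only [M2bound]
  push_cast
  ring

end M2

/-! ## Part 2. Pieces of the top edge

Half-plane labels are those of `WindingCertificate.lean`: `Literature.Complex.qrot d = (-i)^d`, and a
piece with label `d` asserts `Re(qrot d · ζ) > 0`. -/

/-- `Re((-i)^d · z)` for a box `B ∋ z`: `Re z`, `Im z`, `-Re z`, `-Im z`. [folklore] -/
def qrotRe (d : Fin 4) (B : CB) : FI :=
  match d with
  | 0 => B.re
  | 1 => B.im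
  | 2 => B.re.neg
  | 3 => B.im.neg

/-- `Re(qrot d · z) ∈ qrotRe d B` for `z ∈ B`. [folklore] -/
lemma mem_qrotRe (d : Fin 4) {z : ℂ} {B : CB} (h : CB.mem z B) :
    FI.mem (qrot d * z).re (qrotRe d B) := by
  fin_cases d
  · simpa [qrot, qrotRe] using h.1
  · simpa [qrot, qrotRe] using h.2
  · simpa [qrot, qrotRe] using FI.mem_neg h.1
  · simpa [qrot, qrotRe] using FI.mem_neg h.2

/-- `|qrot d| = 1`. [folklore] -/
lemma norm_qrot (d : Fin 4) : ‖qrot d‖ = 1 := by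
  fin_cases d <;> simp [qrot]

/-- The axis directions `1` (index `0`) and `-1` (index `2`); also `i`, `-i`. [folklore] -/
def dirC (i : ℕ) : ℂ := if i = 0 then 1 else if i = 1 then I else if i = 2 then -1 else -I

/-- The box of `dirC i · z` (the engine's `CB.mulIpow`). [folklore] -/
def dirBox (i : ℕ) (B : CB) : CB :=
  if i = 0 then B else if i = 1 then B.mulI else if i = 2 then B.neg else B.mulIpow 3

/-- `dirC i · z ∈ dirBox i B` for `z ∈ B`. [folklore] -/
lemma mem_dirBox {z : ℂ} {B : CB} (h : CB.mem z B) (i : ℕ) :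
    CB.mem (dirC i * z) (dirBox i B) := by
  unfold dirC dirBox
  split_ifs
  · simpa using h
  · rw [mul_comm]; exact CB.mem_mulI h
  · simpa using CB.mem_neg h
  · have h3 := CB.mem_mulIpow h (r := 3) (by norm_num) (by norm_num)
    have e : z * Complex.I ^ (3 : ℤ).toNat = -I * z := by
      rw [show (3 : ℤ).toNat = 3 by rfl, pow_three, ← mul_assoc, ← mul_assoc, mul_assoc z,
        Complex.I_mul_I]; ring
    rwa [e] at h3

/-- `|dirC i| = 1`. [folklore] -/
lemma norm_dirC (i : ℕ) : ‖dirC i‖ = 1 := by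
  unfold dirC; split_ifs <;> simp

/-- `dirC 0 = 1`. [folklore] -/
@[simp] lemma dirC_zero : dirC 0 = 1 := by simp [dirC]

/-- `dirC 2 = -1`. [folklore] -/
@[simp] lemma dirC_two : dirC 2 = -1 := by simp [dirC]

/-- **The basic certified step.** At a checked node `nd`, in direction `dirC i`, with label `d`:
if `ζ` is analytic with `|ζ''| ≤ M2` on the segment of length `len` and the interval inequality
`lo Re(qrot d ζ(nd)) - (len/2)·hi|Re(qrot d · dirC i · ζ'(nd))| - (len²/8) M2 > 0` holds, then
`Re(qrot d · ζ) > 0` on the first half of the segment. [cite: Edwards1974, §6.6] -/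
theorem re_qrot_pos_half {logs : List FI} {K : ℕ} (hl : LogsValid logs K) {nd : Node}
    (hnd : nd.check logs K = true) {i : ℕ} {d : Fin 4} {len M2 : ℚ}
    (hf : ∀ u ∈ Icc (0 : ℝ) len, AnalyticAt ℂ riemannZeta (nd.s + u * dirC i))
    (hM2 : ∀ u ∈ Icc (0 : ℝ) len, ‖deriv (deriv riemannZeta) (nd.s + u * dirC i)‖ ≤ M2)
    (hcond : 0 < (qrotRe d (nd.zetaBox logs)).loQ -
      len / 2 * (qrotRe d (dirBox i (nd.zeta1Box logs))).absHiQ - len ^ 2 / 8 * M2) :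
    ∀ u ∈ Icc (0 : ℝ) (len / 2), 0 < (qrot d * riemannZeta (nd.s + u * dirC i)).re := by
  intro u hu
  have hlen : (0 : ℝ) ≤ len := by linarith [hu.1, hu.2]
  have hu' : u ∈ Icc (0 : ℝ) len := ⟨hu.1, by linarith [hu.2]⟩
  have hT := norm_sub_taylor_le (f := riemannZeta) (norm_dirC i) hf hM2 u hu'
  set E := riemannZeta (nd.s + u * dirC i) - riemannZeta nd.s -
    deriv riemannZeta nd.s * (u * dirC i) with hE
  have hdecomp : qrot d * riemannZeta (nd.s + u * dirC i) =
      qrot d * riemannZeta nd.s + u * (qrot d * (dirC i * deriv riemannZeta nd.s)) +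
        qrot d * E := by
    rw [hE]; ring
  have h0 : ((qrotRe d (nd.zetaBox logs)).loQ : ℝ) ≤ (qrot d * riemannZeta nd.s).re :=
    FI.loQ_le (mem_qrotRe d (nd.mem_zetaBox hl hnd))
  have h1 : |(qrot d * (dirC i * deriv riemannZeta nd.s)).re| ≤
      (qrotRe d (dirBox i (nd.zeta1Box logs))).absHiQ :=
    FI.abs_le_absHiQ (mem_qrotRe d (mem_dirBox (nd.mem_zeta1Box hl hnd) i))
  have h2 : |(qrot d * E).re| ≤ M2 * (len : ℝ) ^ 2 / 8 := by
    calc |(qrot d * E).re| ≤ ‖qrot d * E‖ := Complex.abs_re_le_norm _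
      _ = ‖E‖ := by rw [norm_mul, norm_qrot, one_mul]
      _ ≤ M2 * u ^ 2 / 2 := hT
      _ ≤ M2 * ((len : ℝ) / 2) ^ 2 / 2 := by
          have hM : (0 : ℝ) ≤ M2 := le_trans (norm_nonneg _) (hM2 0 ⟨le_rfl, hlen⟩)
          have hu2 := pow_le_pow_left₀ hu.1 hu.2 2
          exact div_le_div_of_nonneg_right (mul_le_mul_of_nonneg_left hu2 hM) (by norm_num)
      _ = M2 * (len : ℝ) ^ 2 / 8 := by ring
  have hcond' : (0 : ℝ) < (qrotRe d (nd.zetaBox logs)).loQ -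
      len / 2 * (qrotRe d (dirBox i (nd.zeta1Box logs))).absHiQ - len ^ 2 / 8 * M2 := by
    exact_mod_cast hcond
  rw [hdecomp, Complex.add_re, Complex.add_re]
  have hure : ((u : ℂ) * (qrot d * (dirC i * deriv riemannZeta nd.s))).re =
      u * (qrot d * (dirC i * deriv riemannZeta nd.s)).re := by
    rw [Complex.re_ofReal_mul]
  rw [hure]
  rw [abs_le] at h1 h2
  have hu2 : u ≤ len / 2 := hu.2
  have key : -(↑len / 2 * ((qrotRe d (dirBox i (nd.zeta1Box logs))).absHiQ : ℝ)) ≤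
      u * (qrot d * (dirC i * deriv riemannZeta nd.s)).re := by
    have ha : |u * (qrot d * (dirC i * deriv riemannZeta nd.s)).re| ≤
        len / 2 * ((qrotRe d (dirBox i (nd.zeta1Box logs))).absHiQ : ℝ) := by
      rw [abs_mul, abs_of_nonneg hu.1]
      exact mul_le_mul hu2 (abs_le.2 ⟨h1.1, h1.2⟩) (abs_nonneg _) (by linarith [hu.1])
    exact (abs_le.1 ha).1
  linarith [h2.1]

/-- A piece of the top edge: the horizontal segment from node `a` to node `b` (same ordinate,
`a.σ < b.σ`), a half-plane label `d` (the piece asserts `Re((-i)^d ζ) > 0` on the segment),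
and the data `N2, M0, m1` for the second-derivative bound `M2bound`. [folklore] -/
structure Piece where
  /-- left end point -/
  a : Node
  /-- right end point -/
  b : Node
  /-- half-plane label (`WindingCertificate.lean`): `Re(qrot d · ζ) > 0` on the piece -/
  d : Fin 4
  /-- Euler–Maclaurin cut-off for the bound on `ζ''` -/
  N2 : ℕ
  /-- claimed bound `M0 ≥ |s|` on the segment -/
  M0 : ℚ
  /-- claimed bound `m1 ≤ |s - 1|` on the segment -/
  m1 : ℚ

/-- `(x - c)² ≥ dGap c p q` for `x` between `p` and `q`. [folklore] -/
def dGap (c p q : ℚ) : ℚ :=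
  if min p q ≤ c ∧ c ≤ max p q then 0 else min ((p - c) ^ 2) ((q - c) ^ 2)

/-- `dGap c p q ≤ (x - c)²` for `x` between `p` and `q`. [folklore] -/
lemma dGap_le {c p q : ℚ} {x : ℝ} (hx : x ∈ uIcc (p : ℝ) q) : (dGap c p q : ℝ) ≤ (x - c) ^ 2 := by
  unfold dGap
  rw [mem_uIcc] at hx
  split_ifs with h
  · push_cast; exact sq_nonneg _
  · rw [not_and_or, not_le, not_le] at h
    push_cast
    rcases h with h | h
    · have hp : (c : ℝ) < p := by exact_mod_cast h.trans_le (min_le_left p q)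
      have hq : (c : ℝ) < q := by exact_mod_cast h.trans_le (min_le_right p q)
      rcases hx with ⟨h1, h2⟩ | ⟨h1, h2⟩
      · calc min (((p : ℝ) - c) ^ 2) (((q : ℝ) - c) ^ 2) ≤ ((p : ℝ) - c) ^ 2 := min_le_left _ _
          _ ≤ (x - c) ^ 2 := by nlinarith
      · calc min (((p : ℝ) - c) ^ 2) (((q : ℝ) - c) ^ 2) ≤ ((q : ℝ) - c) ^ 2 := min_le_right _ _
          _ ≤ (x - c) ^ 2 := by nlinarith
    · have hp : (p : ℝ) < c := by exact_mod_cast (le_max_left p q).trans_lt h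
      have hq : (q : ℝ) < c := by exact_mod_cast (le_max_right p q).trans_lt h
      rcases hx with ⟨h1, h2⟩ | ⟨h1, h2⟩
      · calc min (((p : ℝ) - c) ^ 2) (((q : ℝ) - c) ^ 2) ≤ ((q : ℝ) - c) ^ 2 := min_le_right _ _
          _ ≤ (x - c) ^ 2 := by nlinarith
      · calc min (((p : ℝ) - c) ^ 2) (((q : ℝ) - c) ^ 2) ≤ ((p : ℝ) - c) ^ 2 := min_le_left _ _
          _ ≤ (x - c) ^ 2 := by nlinarith

/-- `x² ≤ max(p², q²)` for `x` between `p` and `q`. [folklore] -/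
lemma sq_le_max_of_mem_uIcc {p q : ℚ} {x : ℝ} (hx : x ∈ uIcc (p : ℝ) q) :
    x ^ 2 ≤ ((max (p ^ 2) (q ^ 2) : ℚ) : ℝ) := by
  push_cast
  rw [mem_uIcc] at hx
  rcases le_total 0 x with h0 | h0
  · rcases hx with ⟨_, h2⟩ | ⟨_, h2⟩
    · exact (pow_le_pow_left₀ h0 h2 2).trans (le_max_right _ _)
    · exact (pow_le_pow_left₀ h0 h2 2).trans (le_max_left _ _)
  · rcases hx with ⟨h1, _⟩ | ⟨h1, _⟩
    · calc x ^ 2 ≤ (p : ℝ) ^ 2 := by nlinarith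
        _ ≤ _ := le_max_left _ _
    · calc x ^ 2 ≤ (q : ℝ) ^ 2 := by nlinarith
        _ ≤ _ := le_max_right _ _

namespace Piece

variable (P : Piece)

/-- Length `b.σ - a.σ`. [folklore] -/
def len : ℚ := P.b.σ - P.a.σ

/-- Lower bound for `|s - 1|²` on the segment. [folklore] -/
def dmin2 : ℚ := dGap 1 P.a.σ P.b.σ + dGap 0 P.a.t P.b.t

/-- The bound for `|ζ''|` on the piece (`Re s ≥ a.σ` there). [folklore] -/
def M2 (logs : List FI) : ℚ := M2bound logs P.N2 P.a.σ P.M0 P.m1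

/-- The end-point inequality at node `nd` looking in direction `dirC i`. [folklore] -/
def condAt (logs : List FI) (nd : Node) (i : ℕ) : Bool :=
  decide (0 < (qrotRe P.d (nd.zetaBox logs)).loQ -
    P.len / 2 * (qrotRe P.d (dirBox i (nd.zeta1Box logs))).absHiQ - P.len ^ 2 / 8 * P.M2 logs)

/-- **The piece check**: both nodes pass, the piece is horizontal and oriented rightwards, the
claimed bounds `M0 ≥ |s|`, `m1 ≤ |s-1|` hold on the segment, the engine accepts `n^{-a.σ}` for
`n ≤ N2`, and the Taylor test passes from `a` (rightwards) and from `b` (leftwards). [folklore] -/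
def check (logs : List FI) (K : ℕ) : Bool :=
  P.a.check logs K && P.b.check logs K && decide (P.a.t = P.b.t) && decide (P.a.σ < P.b.σ) &&
    decide (1 ≤ P.N2) && decide (P.N2 ≤ K) && decide (0 ≤ P.M0) &&
    decide (max (P.a.σ ^ 2) (P.b.σ ^ 2) + max (P.a.t ^ 2) (P.b.t ^ 2) ≤ P.M0 ^ 2) &&
    decide (0 < P.m1) && decide (P.m1 ^ 2 ≤ P.dmin2) && powNegRangeOK logs P.a.σ P.N2 &&
    P.condAt logs P.a 0 && P.condAt logs P.b 2

/-- The points of the piece: `s(u) = a + u`, `0 ≤ u ≤ len`. [folklore] -/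
def pt (u : ℝ) : ℂ := P.a.s + u

variable {P} {logs : List FI} {K : ℕ}

/-- The conjuncts of the piece check. [folklore] -/
lemma of_check (h : P.check logs K = true) :
    P.a.check logs K = true ∧ P.b.check logs K = true ∧ P.a.t = P.b.t ∧ P.a.σ < P.b.σ ∧
      1 ≤ P.N2 ∧ P.N2 ≤ K ∧ 0 ≤ P.M0 ∧
      max (P.a.σ ^ 2) (P.b.σ ^ 2) + max (P.a.t ^ 2) (P.b.t ^ 2) ≤ P.M0 ^ 2 ∧
      0 < P.m1 ∧ P.m1 ^ 2 ≤ P.dmin2 ∧ powNegRangeOK logs P.a.σ P.N2 = true ∧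
      P.condAt logs P.a 0 = true ∧ P.condAt logs P.b 2 = true := by
  simp only [check, Bool.and_eq_true, decide_eq_true_eq] at h
  obtain ⟨⟨⟨⟨⟨⟨⟨⟨⟨⟨⟨⟨h1, h2⟩, h3⟩, h4⟩, h5⟩, h6⟩, h7⟩, h8⟩, h9⟩, h10⟩, h11⟩, h12⟩, h13⟩ := h
  exact ⟨h1, h2, h3, h4, h5, h6, h7, h8, h9, h10, h11, h12, h13⟩

variable (P)

/-- Real part along the piece. [folklore] -/
lemma pt_re (u : ℝ) : (P.pt u).re = (P.a.σ : ℝ) + u := by simp [pt]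

/-- Imaginary part along the piece. [folklore] -/
lemma pt_im (u : ℝ) : (P.pt u).im = (P.a.t : ℝ) := by simp [pt]

/-- `len = b.σ - a.σ` over `ℝ`. [folklore] -/
lemma len_eq : (P.len : ℝ) = (P.b.σ : ℝ) - (P.a.σ : ℝ) := by simp [len]

variable {P}

/-- Real and imaginary parts along the piece stay between those of the end points. [folklore] -/
lemma pt_re_im (h : P.check logs K = true) {u : ℝ} (hu : u ∈ Icc (0 : ℝ) P.len) :
    (P.pt u).re ∈ uIcc (P.a.σ : ℝ) P.b.σ ∧ (P.pt u).im ∈ uIcc (P.a.t : ℝ) P.b.t := by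
  obtain ⟨-, -, ht, -⟩ := of_check h
  obtain ⟨hu0, hu1⟩ := hu
  rw [P.len_eq] at hu1
  rw [pt_re, pt_im, mem_uIcc, mem_uIcc]
  have ht' : ((P.a.t : ℚ) : ℝ) = P.b.t := by rw [ht]
  exact ⟨Or.inl ⟨by linarith, by linarith⟩, Or.inl ⟨le_rfl, ht'.le⟩⟩

/-- The far end point: `b = a + len`. [folklore] -/
lemma pt_len (h : P.check logs K = true) : P.pt P.len = P.b.s := by
  obtain ⟨-, -, ht, -⟩ := of_check h
  apply Complex.ext
  · rw [pt_re, Node.s_re, P.len_eq]; ring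
  · rw [pt_im, Node.s_im, ht]

/-- Consequences of the check at the points of the piece: `Re s ≥ a.σ`, `|s| ≤ M0`,
`|s - 1| ≥ m1`. [folklore] -/
lemma pt_bounds (h : P.check logs K = true) {u : ℝ} (hu : u ∈ Icc (0 : ℝ) P.len) :
    (P.a.σ : ℝ) ≤ (P.pt u).re ∧ ‖P.pt u‖ ≤ P.M0 ∧ (P.m1 : ℝ) ≤ ‖P.pt u - 1‖ := by
  obtain ⟨hre, him⟩ := pt_re_im h hu
  obtain ⟨-, -, -, -, -, -, hM0, hM, hm1, hm, -⟩ := of_check h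
  refine ⟨?_, ?_, ?_⟩
  · rw [pt_re]; linarith [hu.1]
  · have h1 := sq_le_max_of_mem_uIcc hre
    have h2 := sq_le_max_of_mem_uIcc him
    have hM' : ((max (P.a.σ ^ 2) (P.b.σ ^ 2) + max (P.a.t ^ 2) (P.b.t ^ 2) : ℚ) : ℝ) ≤
        ((P.M0 ^ 2 : ℚ) : ℝ) := by exact_mod_cast hM
    have hns : ‖P.pt u‖ ^ 2 ≤ (P.M0 : ℝ) ^ 2 := by
      rw [Complex.sq_norm, Complex.normSq_apply]
      push_cast at hM' h1 h2 ⊢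
      nlinarith
    have hM0' : (0 : ℝ) ≤ P.M0 := by exact_mod_cast hM0
    exact (pow_le_pow_iff_left₀ (norm_nonneg _) hM0' two_ne_zero).1 hns
  · have h1 := dGap_le (c := 1) hre
    have h2 := dGap_le (c := 0) him
    have hm' : ((P.m1 ^ 2 : ℚ) : ℝ) ≤ ((P.dmin2 : ℚ) : ℝ) := by exact_mod_cast hm
    simp only [dmin2] at hm'
    push_cast at hm' h1 h2
    have hns : (P.m1 : ℝ) ^ 2 ≤ ‖P.pt u - 1‖ ^ 2 := by
      rw [Complex.sq_norm, Complex.normSq_apply]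
      simp only [Complex.sub_re, Complex.one_re, Complex.sub_im, Complex.one_im, sub_zero]
      nlinarith
    have hm1' : (0 : ℝ) ≤ P.m1 := by exact_mod_cast hm1.le
    exact (pow_le_pow_iff_left₀ hm1' (norm_nonneg _) two_ne_zero).1 hns

/-- The piece avoids the pole `s = 1`. [folklore] -/
lemma pt_ne_one (h : P.check logs K = true) {u : ℝ} (hu : u ∈ Icc (0 : ℝ) P.len) :
    P.pt u ≠ 1 := by
  have hm := (pt_bounds h hu).2.2
  obtain ⟨-, -, -, -, -, -, -, -, hm1, -⟩ := of_check h
  have hm1' : (0 : ℝ) < P.m1 := by exact_mod_cast hm1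
  intro he
  rw [he, sub_self, norm_zero] at hm
  linarith

/-- `ζ` is analytic at the points of the piece. [folklore] -/
lemma analyticAt_pt (h : P.check logs K = true) {u : ℝ} (hu : u ∈ Icc (0 : ℝ) P.len) :
    AnalyticAt ℂ riemannZeta (P.pt u) :=
  DifferentiableOn.analyticAt
    (fun _ hz ↦ (differentiableAt_riemannZeta hz).differentiableWithinAt)
    (isOpen_compl_singleton.mem_nhds (pt_ne_one h hu))

/-- `|ζ''| ≤ M2` on the piece. [folklore] -/
lemma norm_deriv2_pt_le (hl : LogsValid logs K) (h : P.check logs K = true) {u : ℝ}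
    (hu : u ∈ Icc (0 : ℝ) P.len) : ‖deriv (deriv riemannZeta) (P.pt u)‖ ≤ P.M2 logs := by
  obtain ⟨hre, hM, hm⟩ := pt_bounds h hu
  obtain ⟨ha, -, -, -, hN2, hN2K, hM0, -, hm1, -, hpow, -⟩ := of_check h
  exact norm_deriv2_zeta_le hl hN2 hN2K (powNegRangeOK_spec hpow) (Node.σ_nonneg ha) hm1 hM0
    hre hM hm

/-- **Soundness of the piece check**: `Re((-i)^d ζ(s)) > 0` along the whole piece.
[cite: Edwards1974, §6.6] -/
theorem re_qrot_pos_of_check (hl : LogsValid logs K) (h : P.check logs K = true) :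
    ∀ u ∈ Icc (0 : ℝ) P.len, 0 < (qrot P.d * riemannZeta (P.pt u)).re := by
  obtain ⟨ha, hb, -, -, -, -, -, -, -, -, -, hca, hcb⟩ := of_check h
  simp only [condAt, decide_eq_true_eq] at hca hcb
  -- from `a`, rightwards
  have hA : ∀ u ∈ Icc (0 : ℝ) (P.len / 2),
      0 < (qrot P.d * riemannZeta (P.a.s + u * dirC 0)).re :=
    re_qrot_pos_half hl ha
      (fun u hu ↦ by rw [dirC_zero, mul_one]; exact analyticAt_pt h hu)
      (fun u hu ↦ by rw [dirC_zero, mul_one]; exact norm_deriv2_pt_le hl h hu) hca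
  -- from `b`, leftwards
  have hrev : ∀ u : ℝ, P.b.s + u * dirC 2 = P.pt (P.len - u) := by
    intro u
    rw [dirC_two, ← pt_len h]
    unfold pt; push_cast; ring
  have hB : ∀ u ∈ Icc (0 : ℝ) (P.len / 2),
      0 < (qrot P.d * riemannZeta (P.b.s + u * dirC 2)).re := by
    refine re_qrot_pos_half hl hb (fun u hu ↦ ?_) (fun u hu ↦ ?_) hcb
    · rw [hrev]; exact analyticAt_pt h ⟨by linarith [hu.2], by linarith [hu.1]⟩
    · rw [hrev]; exact norm_deriv2_pt_le hl h ⟨by linarith [hu.2], by linarith [hu.1]⟩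
  intro u hu
  rcases le_or_gt u (P.len / 2) with hle | hgt
  · have := hA u ⟨hu.1, hle⟩
    rwa [dirC_zero, mul_one] at this
  · have := hB (P.len - u) ⟨by linarith [hu.2], by linarith⟩
    rwa [hrev, show (P.len : ℝ) - (P.len - u) = u by ring] at this

/-- The same along the abscissa: `Re((-i)^d ζ(x + it)) > 0` for `a.σ ≤ x ≤ b.σ`, `t = a.t`.
[cite: Edwards1974, §6.6] -/
theorem re_qrot_pos_Icc (hl : LogsValid logs K) (h : P.check logs K = true)
    {x : ℝ} (hx : x ∈ Icc ((P.a.σ : ℚ) : ℝ) ((P.b.σ : ℚ) : ℝ)) :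
    0 < (qrot P.d * riemannZeta (x + (P.a.t : ℝ) * I)).re := by
  have hu : x - (P.a.σ : ℝ) ∈ Icc (0 : ℝ) P.len := by
    rw [P.len_eq]; exact ⟨by linarith [hx.1], by linarith [hx.2]⟩
  have := re_qrot_pos_of_check hl h _ hu
  have e : P.pt (x - (P.a.σ : ℝ)) = x + (P.a.t : ℝ) * I := by
    apply Complex.ext
    · rw [pt_re]; simp
    · rw [pt_im]; simp
  rwa [e] at this

end Piece

/-! ### From checked pieces to an `HPieces` certificate -/

/-- The piece list in the format of `WindingCertificate.lean`: (right end point, label).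
[folklore] -/
def realize : List Piece → List (ℝ × Fin 4)
  | [] => []
  | P :: L => (((P.b.σ : ℚ) : ℝ), P.d) :: realize L

/-- Chaining of the pieces at height `T`: each piece starts at the abscissa where the previous
one ended. [folklore] -/
def chainOK (T : ℚ) : List Piece → ℚ → Bool
  | [], _ => true
  | P :: L, σ₀ => decide (P.a.σ = σ₀) && decide (P.a.t = T) && chainOK T L P.b.σ

/-- The abscissa of the last end point. [folklore] -/
def lastσ : List Piece → ℚ → ℚ
  | [], σ₀ => σ₀
  | P :: L, _ => lastσ L P.b.σ

/-- The last label. [folklore] -/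
def lastDir : List Piece → Fin 4 → Fin 4
  | [], d => d
  | P :: L, _ => lastDir L P.d

/-- The signed quarter turns of the labels (`Literature.Analysis.Complex.piecesTurns` of the realisation).
[folklore] -/
def turns : List Piece → Fin 4 → ℤ
  | [], _ => 0
  | P :: L, d => qturn d P.d + turns L P.d

/-- [folklore] -/
lemma piecesLast_realize : ∀ (L : List Piece) (σ₀ : ℚ),
    piecesLast ((σ₀ : ℚ) : ℝ) (realize L) = ((lastσ L σ₀ : ℚ) : ℝ)
  | [], _ => rfl
  | P :: L, _ => by simp only [realize, piecesLast_cons, lastσ]; exact piecesLast_realize L P.b.σ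

/-- [folklore] -/
lemma piecesLastDir_realize : ∀ (L : List Piece) (d : Fin 4),
    piecesLastDir d (realize L) = lastDir L d
  | [], _ => rfl
  | P :: L, _ => by
    simp only [realize, piecesLastDir_cons, lastDir]; exact piecesLastDir_realize L P.d

/-- [folklore] -/
lemma piecesTurns_realize : ∀ (L : List Piece) (d : Fin 4),
    piecesTurns d (realize L) = turns L d
  | [], _ => rfl
  | P :: L, d => by simp only [realize, piecesTurns_cons, turns]; rw [piecesTurns_realize L P.d]

/-- **Checked, chained pieces form a valid horizontal piece list for `ζ`** at height `T`,
starting at `σ₀`. [cite: Edwards1974, §6.6] -/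
theorem hpieces_realize {logs : List FI} {K : ℕ} (hl : LogsValid logs K) {T : ℚ} :
    ∀ (L : List Piece) (σ₀ : ℚ), (∀ P ∈ L, P.check logs K = true) → chainOK T L σ₀ = true →
      HPieces riemannZeta ((T : ℚ) : ℝ) ((σ₀ : ℚ) : ℝ) (realize L)
  | [], _, _, _ => trivial
  | P :: L, σ₀, hall, hch => by
    simp only [chainOK, Bool.and_eq_true, decide_eq_true_eq] at hch
    obtain ⟨⟨hσ, hat⟩, hrest⟩ := hch
    have hP : P.check logs K = true := hall P (by simp)
    obtain ⟨-, -, -, hlt, -⟩ := Piece.of_check hP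
    rw [realize, HPieces_cons]
    refine ⟨?_, ?_, hpieces_realize hl L P.b.σ (fun Q hQ ↦ hall Q (List.mem_cons_of_mem P hQ))
      hrest⟩
    · rw [← hσ]; exact_mod_cast hlt.le
    · intro x hx
      rw [← hσ] at hx
      have := Piece.re_qrot_pos_Icc hl hP hx
      rwa [hat] at this

/-! ## Part 3. Brackets on the critical line and the Stirling inequality -/

/-- A bracket: two nodes `½ + it₁`, `½ + it₂` on the critical line. [folklore] -/
abbrev Bracket := Node × Node

namespace Bracket

/-- Upper end point (scaled) of `Re(ζ(s₁) · conj ζ(s₂)) = Re ζ₁ Re ζ₂ + Im ζ₁ Im ζ₂` from the node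
enclosures. [folklore] -/
def reProdHi (logs : List FI) (B : Bracket) : ℤ :=
  (((B.1.zetaBox logs).re.mul (B.2.zetaBox logs).re).add
    ((B.1.zetaBox logs).im.mul (B.2.zetaBox logs).im)).hi

/-- **The bracket check**: both nodes pass and lie on the critical line, `1 ≤ t₁ ≤ t₂`,
`t₂ - t₁ ≤ 1/8`, and `Re(ζ(½+it₁) conj ζ(½+it₂)) < 0` certifiedly. [folklore] -/
def check (logs : List FI) (K : ℕ) (B : Bracket) : Bool :=
  B.1.check logs K && B.2.check logs K && decide (B.1.σ = 1 / 2) && decide (B.2.σ = 1 / 2) &&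
    decide (1 ≤ B.1.t) && decide (B.1.t ≤ B.2.t) && decide (B.2.t - B.1.t ≤ 1 / 8) &&
    decide (B.reProdHi logs < 0)

/-- A node with `σ = ½` is the point `½ + it`. [folklore] -/
lemma s_eq_half {nd : Node} (h : nd.σ = 1 / 2) : nd.s = 1 / 2 + (nd.t : ℝ) * I := by
  rw [Node.s_eq, h]; push_cast; ring

/-- **A checked bracket contains a zero of `ζ` on the critical line** (twisted sign test,
`Literature.NumberTheory.LFunctions.exists_zero_Icc_of_re_mul_conj_neg'`). [cite: Brent1979, §3] -/
theorem exists_zero {logs : List FI} {K : ℕ} (hl : LogsValid logs K) {B : Bracket}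
    (h : B.check logs K = true) (h20 : ((B.2.t : ℚ) : ℝ) ≤ 2 ^ 20) :
    ∃ γ ∈ Icc ((B.1.t : ℚ) : ℝ) B.2.t, riemannZeta (1 / 2 + γ * I) = 0 := by
  have h' := h
  simp only [check, Bool.and_eq_true, decide_eq_true_eq] at h'
  obtain ⟨⟨⟨⟨⟨⟨⟨h1, h2⟩, hs1⟩, hs2⟩, ht1⟩, ht12⟩, hgap⟩, hneg⟩ := h'
  have m1 := B.1.mem_zetaBox hl h1
  have m2 := B.2.mem_zetaBox hl h2
  rw [s_eq_half hs1] at m1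
  rw [s_eq_half hs2] at m2
  set z1 := riemannZeta (1 / 2 + ((B.1.t : ℚ) : ℝ) * I)
  set z2 := riemannZeta (1 / 2 + ((B.2.t : ℚ) : ℝ) * I)
  have hre : (z1 * conj z2).re = z1.re * z2.re + z1.im * z2.im := by
    simp [Complex.mul_re, Complex.conj_re, Complex.conj_im]
  have hmem : FI.mem (z1 * conj z2).re
      ((((B.1.zetaBox logs).re.mul (B.2.zetaBox logs).re).add
        ((B.1.zetaBox logs).im.mul (B.2.zetaBox logs).im))) := by
    rw [hre]
    exact FI.mem_add (FI.mem_mul m1.1 m2.1) (FI.mem_mul m1.2 m2.2)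
  have hlt : (z1 * conj z2).re < 0 := by
    have hhi := hmem.2
    have hneg' : (((((B.1.zetaBox logs).re.mul (B.2.zetaBox logs).re).add
        ((B.1.zetaBox logs).im.mul (B.2.zetaBox logs).im))).hi : ℝ) < 0 := by
      unfold reProdHi at hneg; exact_mod_cast hneg
    nlinarith [SC_pos]
  have ht1' : (1 : ℝ) ≤ ((B.1.t : ℚ) : ℝ) := by
    have := Rat.cast_le (K := ℝ).2 ht1; push_cast at this; exact this
  have ht12' : ((B.1.t : ℚ) : ℝ) ≤ ((B.2.t : ℚ) : ℝ) := Rat.cast_le.2 ht12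
  have hgap' : ((B.2.t : ℚ) : ℝ) - ((B.1.t : ℚ) : ℝ) ≤ 1 / 8 := by
    have := Rat.cast_le (K := ℝ).2 hgap; push_cast at this; linarith
  exact exists_zero_Icc_of_re_mul_conj_neg' ht1' ht12' h20 hgap' hlt

end Bracket

/-- Checking a list of brackets below height `T`, sorted and pairwise separated, starting above
height `h`. [folklore] -/
def bracketsOK (logs : List FI) (K : ℕ) (T : ℚ) : List Bracket → ℚ → Bool
  | [], h => decide (h ≤ T)
  | B :: L, h => B.check logs K && decide (h < B.1.t) && decide (B.2.t ≤ T) &&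
      bracketsOK logs K T L B.2.t

/-- **Separated checked brackets give at least as many zeros on the critical line**:
`N₀(h) + #brackets ≤ N₀(T)`. [cite: Brent1979, §3] -/
theorem criticalZeroCount_add_length_le {logs : List FI} {K : ℕ} (hl : LogsValid logs K)
    {T : ℚ} (hT20 : (T : ℝ) ≤ 2 ^ 20) :
    ∀ (L : List Bracket) (h : ℚ), 0 ≤ h → bracketsOK logs K T L h = true →
      criticalZeroCount (h : ℝ) + L.length ≤ criticalZeroCount (T : ℝ)
  | [], h, h0, hok => by
    simp only [bracketsOK, decide_eq_true_eq] at hok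
    have h0' : (0 : ℝ) ≤ (h : ℝ) := by exact_mod_cast h0
    have hok' : ((h : ℚ) : ℝ) ≤ (T : ℝ) := by exact_mod_cast hok
    have := criticalZeroCount_add_card_le h0' hok' ∅ (by simp)
    simpa using this
  | B :: L, h, h0, hok => by
    simp only [bracketsOK, Bool.and_eq_true, decide_eq_true_eq] at hok
    obtain ⟨⟨⟨hB, hhB⟩, hBT⟩, hrest⟩ := hok
    have hB' := hB
    simp only [Bracket.check, Bool.and_eq_true, decide_eq_true_eq] at hB'
    have ht12 : B.1.t ≤ B.2.t := hB'.1.1.2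
    obtain ⟨γ, hγ, hz⟩ :=
      Bracket.exists_zero hl hB ((by exact_mod_cast hBT : _ ≤ (T : ℝ)).trans hT20)
    have h0' : (0 : ℝ) ≤ (h : ℝ) := by exact_mod_cast h0
    have hhB' : ((h : ℚ) : ℝ) < ((B.1.t : ℚ) : ℝ) := by exact_mod_cast hhB
    have ht12' : ((B.1.t : ℚ) : ℝ) ≤ ((B.2.t : ℚ) : ℝ) := by exact_mod_cast ht12
    have h1 : criticalZeroCount (h : ℝ) + 1 ≤ criticalZeroCount ((B.2.t : ℚ) : ℝ) := by
      have := criticalZeroCount_add_card_le (a := (h : ℝ)) (b := ((B.2.t : ℚ) : ℝ))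
        h0' (by linarith) {γ}
        (fun x hx ↦ by
          rw [Finset.mem_singleton] at hx; subst hx
          exact ⟨hz, lt_of_lt_of_le hhB' hγ.1, hγ.2⟩)
      simpa using this
    have h2 := criticalZeroCount_add_length_le hl hT20 L B.2.t
      (h0.trans ((le_of_lt hhB).trans ht12)) hrest
    simp only [List.length_cons]
    omega

/-! ### The Stirling inequality in interval arithmetic -/

section Stirling

variable (logs : List FI)

/-- `log 2` from the table. [folklore] -/
def LOG2 : FI := logs.getD 2 (FI.ofInt 0)

/-- `log 3` from the table. [folklore] -/
def LOG3 : FI := logs.getD 3 (FI.ofInt 0)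

/-- `1 - 3/π` (total version). [folklore] -/
def xPi : FI := (FI.ofInt 1).sub ((FI.divPos (FI.ofInt 3) FI.pi).getD (FI.ofInt 0))

/-- `log π = log 3 - log(1 - (1 - 3/π))`. [folklore] -/
def LOGPI : FI := (LOG3 logs).sub (FI.logOneSubD xPi 30)

/-- Validity of `LOGPI`. [folklore] -/
def logPiOK : Bool := (FI.divPos (FI.ofInt 3) FI.pi).isSome && FI.logOneSubOK xPi 30

/-- `log T = j log 2 + log(1 - (1 - T/2^j))` for the supplied exponent `j` (valid when
`T/2^j ∈ [½, 1]`). [folklore] -/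
def LOGT (T : ℚ) (j : ℕ) : FI :=
  ((LOG2 logs).mulInt j).add (FI.logOneSubD (FI.ofRat (1 - T / 2 ^ j)) 60)

/-- [folklore] -/
def logTOK (T : ℚ) (j : ℕ) : Bool := FI.logOneSubOK (FI.ofRat (1 - T / 2 ^ j)) 60

/-- `V = M(T) + (1 - turns/2 - n) π`, `M(T) = (T/2) log(T/2π) - T/2 - π/8`. [folklore] -/
def stirV (T : ℚ) (j : ℕ) (tu : ℤ) (n : ℕ) : FI :=
  let L := ((LOGT logs T j).sub (LOG2 logs)).sub (LOGPI logs)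
  let M := ((L.mul (FI.ofRat (T / 2))).sub (FI.ofRat (T / 2))).sub (FI.pi.divNat 8)
  M.add (FI.pi.mul (FI.ofRat (1 - (tu : ℚ) / 2 - n)))

/-- `W = 2 K(¼)/T`, `K(¼) = 31/96 + π/12` (`Literature.NumberTheory.LFunctions.stirlingVertRate`). [folklore] -/
def stirW (T : ℚ) : FI := ((FI.ofRat (31 / 96)).add (FI.pi.divNat 12)).mul (FI.ofRat (2 / T))

/-- **The Stirling inequality check**: certifies
`|M(T)/π + 1 - turns/2 - n| + 2K(¼)/(πT) ≤ 1/2` in the form `±V + W ≤ π/2`. [folklore] -/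
def stirlingCheck (T : ℚ) (j : ℕ) (tu : ℤ) (n : ℕ) : Bool :=
  logPiOK && logTOK T j &&
    decide (2 * ((stirV logs T j tu n).add (stirW T)).hi ≤ FI.pi.lo) &&
    decide (2 * ((stirV logs T j tu n).neg.add (stirW T)).hi ≤ FI.pi.lo)

variable {logs} {K : ℕ}

/-- `log π ∈ LOGPI`. [folklore] -/
lemma mem_LOGPI (hl : LogsValid logs K) (hK : 3 ≤ K) (h : logPiOK = true) :
    FI.mem (Real.log π) (LOGPI logs) := by
  simp only [logPiOK, Bool.and_eq_true] at h
  obtain ⟨hd, hp⟩ := h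
  have m3 : FI.mem (Real.log 3) (LOG3 logs) := by simpa [LOG3] using hl 3 hK
  obtain ⟨Q, hQ⟩ := Option.isSome_iff_exists.1 hd
  have hq : FI.mem (3 / π) Q := FI.mem_divPos hQ (by simpa using FI.mem_ofInt 3) FI.mem_pi
  have hx : FI.mem (1 - 3 / π) xPi := by
    rw [xPi, hQ, Option.getD_some]
    exact FI.mem_sub (by simpa using FI.mem_ofInt 1) hq
  have := FI.mem_logOneSubD hp hx
  have e : Real.log (1 - (1 - 3 / π)) = Real.log 3 - Real.log π := by
    rw [show (1 : ℝ) - (1 - 3 / π) = 3 / π by ring, Real.log_div (by norm_num) Real.pi_pos.ne']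
  rw [e] at this
  have := FI.mem_sub m3 this
  rw [show Real.log 3 - (Real.log 3 - Real.log π) = Real.log π by ring] at this
  exact this

/-- `log T ∈ LOGT T j`. [folklore] -/
lemma mem_LOGT (hl : LogsValid logs K) (hK : 3 ≤ K) {T : ℚ} (hT : 0 < T) {j : ℕ}
    (h : logTOK T j = true) : FI.mem (Real.log T) (LOGT logs T j) := by
  have m2 : FI.mem (Real.log 2) (LOG2 logs) := by simpa [LOG2] using hl 2 (by omega)
  have := FI.mem_logOneSubD h (FI.mem_ofRat (1 - T / 2 ^ j))
  have e : Real.log (1 - ((1 - T / 2 ^ j : ℚ) : ℝ)) = Real.log T - j * Real.log 2 := by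
    push_cast
    rw [show (1 : ℝ) - (1 - (T : ℝ) / 2 ^ j) = T / 2 ^ j by ring,
      Real.log_div (by exact_mod_cast hT.ne') (by positivity), Real.log_pow]
  rw [e] at this
  have := FI.mem_add (FI.mem_mulInt m2 j) this
  rw [show Real.log 2 * (j : ℤ) + (Real.log T - j * Real.log 2) = Real.log T by push_cast; ring]
    at this
  exact this

/-- **Soundness of the Stirling check**: the hypothesis `hV` of
`Literature.NumberTheory.LFunctions.MertensZeroCertificate.zetaZeroCount_eq_of_hpieces_stirling`. [cite: Titchmarsh1986, Thm. 9.3 and §4.17] -/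
theorem stirling_of_check (hl : LogsValid logs K) (hK : 3 ≤ K) {T : ℚ} (hT : 0 < T) {j : ℕ}
    {tu : ℤ} {n : ℕ} (h : stirlingCheck logs T j tu n = true) :
    |((T : ℝ) / 2 * Real.log ((T : ℝ) / (2 * π)) - (T : ℝ) / 2 - π / 8) / π + 1 -
        (tu : ℝ) / 2 - n| + 2 * stirlingVertRate (1 / 4) / (π * (T : ℝ)) ≤ 1 / 2 := by
  simp only [stirlingCheck, Bool.and_eq_true, decide_eq_true_eq] at h
  obtain ⟨⟨⟨hlp, hj⟩, hplus⟩, hminus⟩ := h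
  have m2 : FI.mem (Real.log 2) (LOG2 logs) := by simpa [LOG2] using hl 2 (by omega)
  have mπ := mem_LOGPI hl hK hlp
  have mT := mem_LOGT hl hK hT hj
  have hπ := Real.pi_pos
  have hT' : (0 : ℝ) < T := by exact_mod_cast hT
  set M : ℝ := (T : ℝ) / 2 * Real.log ((T : ℝ) / (2 * π)) - (T : ℝ) / 2 - π / 8 with hM
  set V : ℝ := M + π * (1 - (tu : ℝ) / 2 - n) with hV
  set W : ℝ := (31 / 96 + π / 12) * (2 / (T : ℝ)) with hW
  have mV : FI.mem V (stirV logs T j tu n) := by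
    have hlog : Real.log ((T : ℝ) / (2 * π)) = Real.log T - Real.log 2 - Real.log π := by
      rw [Real.log_div hT'.ne' (by positivity), Real.log_mul (by norm_num) hπ.ne']; ring
    have mL : FI.mem (Real.log T - Real.log 2 - Real.log π)
        (((LOGT logs T j).sub (LOG2 logs)).sub (LOGPI logs)) :=
      FI.mem_sub (FI.mem_sub mT m2) mπ
    have mM : FI.mem ((Real.log T - Real.log 2 - Real.log π) * ((T / 2 : ℚ) : ℝ) -
        ((T / 2 : ℚ) : ℝ) - π / 8)
        ((((((LOGT logs T j).sub (LOG2 logs)).sub (LOGPI logs)).mul (FI.ofRat (T / 2))).sub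
          (FI.ofRat (T / 2))).sub (FI.pi.divNat 8)) :=
      FI.mem_sub (FI.mem_sub (FI.mem_mul mL (FI.mem_ofRat (T / 2))) (FI.mem_ofRat (T / 2)))
        (FI.mem_divNat FI.mem_pi (n := 8) (by norm_num))
    have mc : FI.mem (π * (((1 - (tu : ℚ) / 2 - n : ℚ)) : ℝ))
        (FI.pi.mul (FI.ofRat (1 - (tu : ℚ) / 2 - n))) :=
      FI.mem_mul FI.mem_pi (FI.mem_ofRat (1 - (tu : ℚ) / 2 - n))
    have key : FI.mem ((Real.log T - Real.log 2 - Real.log π) * ((T / 2 : ℚ) : ℝ) -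
        ((T / 2 : ℚ) : ℝ) - π / 8 + π * (((1 - (tu : ℚ) / 2 - n : ℚ)) : ℝ))
        (stirV logs T j tu n) :=
      FI.mem_add mM mc
    have e : (Real.log T - Real.log 2 - Real.log π) * ((T / 2 : ℚ) : ℝ) -
        ((T / 2 : ℚ) : ℝ) - π / 8 + π * (((1 - (tu : ℚ) / 2 - n : ℚ)) : ℝ) = V := by
      rw [hV, hM, hlog]; push_cast; ring
    rw [← e]; exact key
  have mW : FI.mem W (stirW T) := by
    have key : FI.mem ((((31 / 96 : ℚ) : ℝ) + π / 12) * ((2 / T : ℚ) : ℝ)) (stirW T) :=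
      FI.mem_mul (FI.mem_add (FI.mem_ofRat (31 / 96)) (FI.mem_divNat FI.mem_pi (n := 12)
        (by norm_num))) (FI.mem_ofRat (2 / T))
    have e : (((31 / 96 : ℚ) : ℝ) + π / 12) * ((2 / T : ℚ) : ℝ) = W := by
      rw [hW]; push_cast; ring
    rw [← e]; exact key
  have hSC := SC_pos
  have hp : ((FI.pi.lo : ℤ) : ℝ) ≤ π * SC := FI.mem_pi.1
  have i1 : 2 * (V + W) ≤ π := by
    have hm : (V + W) * SC ≤ ((((stirV logs T j tu n).add (stirW T)).hi : ℤ) : ℝ) :=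
      (FI.mem_add mV mW).2
    have hc : (2 : ℝ) * ((((stirV logs T j tu n).add (stirW T)).hi : ℤ) : ℝ) ≤
        ((FI.pi.lo : ℤ) : ℝ) := by
      exact_mod_cast hplus
    have h3 : 2 * (V + W) * SC ≤ π * SC := by linarith
    exact le_of_mul_le_mul_right h3 hSC
  have i2 : 2 * (-V + W) ≤ π := by
    have hm : (-V + W) * SC ≤ ((((stirV logs T j tu n).neg.add (stirW T)).hi : ℤ) : ℝ) :=
      (FI.mem_add (FI.mem_neg mV) mW).2
    have hc : (2 : ℝ) * ((((stirV logs T j tu n).neg.add (stirW T)).hi : ℤ) : ℝ) ≤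
        ((FI.pi.lo : ℤ) : ℝ) := by
      exact_mod_cast hminus
    have h3 : 2 * (-V + W) * SC ≤ π * SC := by linarith
    exact le_of_mul_le_mul_right h3 hSC
  have iabs : |V| + W ≤ π / 2 := by
    rcases le_or_gt 0 V with h0 | h0
    · rw [abs_of_nonneg h0]; linarith
    · rw [abs_of_neg h0]; linarith
  have e1 : M / π + 1 - (tu : ℝ) / 2 - n = V / π := by
    rw [hV]; field_simp; ring
  have e2 : 2 * stirlingVertRate (1 / 4) / (π * (T : ℝ)) = W / π := by
    rw [hW, stirlingVertRate]; field_simp; ring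
  rw [e1, e2, abs_div, abs_of_pos hπ, ← add_div, div_le_iff₀ hπ]
  linarith

end Stirling

/-! ## Part 4. Certificates and the verifier -/

/-- **A certificate for `RiemannHypothesisUpTo T`**: the logarithm table, the pieces of the top
edge `[½, 2] × {T}` (left to right), one bracket per zero with ordinate in `(0, T]` (in increasing
order), and the exponent `j` with `T/2^j ∈ [½, 1]` used for `log T`. [folklore] -/
structure RHCert where
  /-- height -/
  T : ℚ
  /-- table of `log n`, `n = 0, 1, …, K` (must coincide with `FI.logTable K`) -/
  logs : List FI
  /-- pieces of the top edge from `½ + iT` to `2 + iT` -/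
  top : List Piece
  /-- brackets around the zeros on the critical line with ordinates in `(0, T]` -/
  brackets : List Bracket
  /-- exponent for `log T = j log 2 + log(T/2^j)` -/
  j : ℕ

namespace RHCert

variable (C : RHCert)

/-- Largest usable index of the table (`ℕ`-subtraction). [folklore] -/
def K : ℕ := C.logs.length - 1

/-- **The certificate checker**: `2 ≤ T ≤ 2²⁰`, a valid table with `K ≥ 3`, a nonempty chained
list of checked pieces from abscissa `½` to `2` ending with label `0`, checked brackets, and the
Stirling inequality for `n = #brackets`. [folklore] -/
def check : Bool :=
  match C.top with
  | [] => false
  | P :: L =>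
    decide (2 ≤ C.T) && decide (C.T ≤ 2 ^ 20) && decide (3 ≤ C.K) && logsCheck C.logs C.K &&
      (P :: L).all (fun Q ↦ Q.check C.logs C.K) && chainOK C.T (P :: L) (1 / 2) &&
      decide (lastσ L P.b.σ = 2) && decide (lastDir L P.d = 0) &&
      bracketsOK C.logs C.K C.T C.brackets 0 &&
      stirlingCheck C.logs C.T C.j (turns L P.d) C.brackets.length

/-- **Soundness of the certificate checker**: an accepted certificate proves the Riemann
hypothesis up to height `T` — `N(T) = n` from the top edge
(`Literature.NumberTheory.LFunctions.MertensZeroCertificate.zetaZeroCount_eq_of_hpieces_stirling`), `n ≤ N₀(T)` from the brackets, and Turing's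
reduction `Literature.NumberTheory.DiophantineGeometry.RiemannHypothesisUpTo.of_zetaZeroCount_le_criticalZeroCount`.
[cite: Edwards1974, §6.6] -/
theorem sound {C : RHCert} (h : C.check = true) : DiophantineGeometry.RiemannHypothesisUpTo (C.T : ℝ) := by
  unfold check at h
  split at h
  · exact absurd h Bool.false_ne_true
  · rename_i P L hPL
    simp only [Bool.and_eq_true, decide_eq_true_eq] at h
    obtain ⟨⟨⟨⟨⟨⟨⟨⟨⟨hT2, hT20⟩, hK3⟩, hlogs⟩, hall⟩, hchain⟩, hlast⟩, hdir⟩, hbr⟩, hst⟩ := h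
    have hl := logsValid_of_check hlogs
    have hT0 : (0 : ℚ) < C.T := by linarith
    have hT20' : ((C.T : ℚ) : ℝ) ≤ 2 ^ 20 := by exact_mod_cast hT20
    -- the top edge
    have hall' : ∀ Q ∈ P :: L, Q.check C.logs C.K = true := by
      intro Q hQ; exact List.all_eq_true.1 hall Q hQ
    have hH := hpieces_realize hl (P :: L) (1 / 2) hall' hchain
    rw [realize] at hH
    have hH' : HPieces riemannZeta ((C.T : ℚ) : ℝ) (1 / 2)
        ((((P.b.σ : ℚ) : ℝ), P.d) :: realize L) := by
      convert hH using 2; norm_num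
    have hlast' : piecesLast ((P.b.σ : ℚ) : ℝ) (realize L) = 2 := by
      rw [piecesLast_realize, hlast]; norm_num
    have hdir' : piecesLastDir P.d (realize L) = 0 := by rw [piecesLastDir_realize, hdir]
    have hV := stirling_of_check hl hK3 hT0 hst
    rw [← piecesTurns_realize] at hV
    have hN := MertensZeroCertificate.zetaZeroCount_eq_of_hpieces_stirling (by exact_mod_cast hT2) hH' hlast' hdir' hV
    -- the brackets
    have hN0 := criticalZeroCount_add_length_le hl hT20' C.brackets 0 le_rfl hbr
    refine DiophantineGeometry.RiemannHypothesisUpTo.of_zetaZeroCount_le_criticalZeroCount ?_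
    rw [hN]
    push_cast at hN0
    omega

end RHCert

/-- **Backlund's verifier for RH up to integer heights** (`Literature.NumberTheory.DiophantineGeometry.RHVerifier`): certificates are
`RHCert`s of height `≥ T`. Usage:
`riemannHypothesisUpTo_of_check backlundVerifier C (by decide +kernel)`. [cite: Edwards1974, §6.6] -/
def backlundVerifier : DiophantineGeometry.RHVerifier where
  Cert := RHCert
  check T C := decide ((T : ℚ) ≤ C.T) && C.check
  sound T C h := by
    simp only [Bool.and_eq_true, decide_eq_true_eq] at h
    exact (RHCert.sound h.2).mono_of_le (by exact_mod_cast h.1)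

/-! ## Part 5. The certificate for `T = 16` -/

namespace RH16

/-- The logarithms `log n`, `n ≤ 20`, exactly as computed by `FI.logTable 20` (the checker
recomputes the table and compares). [folklore] -/
def theLogs : List FI :=
  [{ lo := 0, hi := 0 },
 { lo := 0, hi := 0 },
 { lo := 195103586505146, hi := 195103586505194 },
 { lo := 309231868366860, hi := 309231868366965 },
 { lo := 390207173010287, hi := 390207173010441 },
 { lo := 453016498919577, hi := 453016498919785 },
 { lo := 504335454871993, hi := 504335454872256 },
 { lo := 547725013886292, hi := 547725013886609 },
 { lo := 585310759515413, hi := 585310759515780 },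
 { lo := 618463736733695, hi := 618463736734116 },
 { lo := 648120085424695, hi := 648120085425171 },
 { lo := 674947516065398, hi := 674947516065928 },
 { lo := 699439041377109, hi := 699439041377693 },
 { lo := 721969060655368, hi := 721969060656008 },
 { lo := 742828600391403, hi := 742828600392097 },
 { lo := 762248367286385, hi := 762248367287134 },
 { lo := 780414346020518, hi := 780414346021317 },
 { lo := 797478660034383, hi := 797478660035236 },
 { lo := 813567323238792, hi := 813567323239699 },
 { lo := 828785893086644, hi := 828785893087605 },
 { lo := 843223671929786, hi := 843223671930801 }]

/-- Pieces of the top edge `½ + 16i → 2 + 16i` (2 pieces, label `0`: `Re ζ > 0`). [folklore] -/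
def theTop : List Piece :=
  [⟨⟨((1 : ℚ) / 2), (16 : ℚ), 12, ((1025 : ℚ) / 64)⟩,
      ⟨((3 : ℚ) / 2), (16 : ℚ), 8, ((1029 : ℚ) / 64)⟩, 0, 4, ((1029 : ℚ) / 64), ((1023 : ℚ) / 64)⟩,
   ⟨⟨((3 : ℚ) / 2), (16 : ℚ), 8, ((1029 : ℚ) / 64)⟩,
      ⟨(2 : ℚ), (16 : ℚ), 7, ((129 : ℚ) / 8)⟩, 0, 5, ((129 : ℚ) / 8), (16 : ℚ)⟩]

/-- The bracket `[225/16, 227/16]` around `γ₁ = 14.1347…` on the critical line. [folklore] -/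
def theBrackets : List Bracket :=
  [(⟨((1 : ℚ) / 2), ((225 : ℚ) / 16), 19, ((901 : ℚ) / 64)⟩,
    ⟨((1 : ℚ) / 2), ((227 : ℚ) / 16), 20, ((909 : ℚ) / 64)⟩)]

/-- **The certificate for `T = 16`** (exponent `j = 4`: `16/2⁴ = 1`). It was produced by an
external planner in floating point (`N` per node, `M0`, `m1`, `N2` per piece) and is validated
here by the kernel only. [folklore] -/
def theCert : RHCert := ⟨16, theLogs, theTop, theBrackets, 4⟩

/-- **The checker accepts the certificate** (evaluated by the kernel, a few seconds).
[folklore] -/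
theorem theCert_check : theCert.check = true := by
  decide +kernel

end RH16

end Literature.NumberTheory.LFunctions.ZetaCert

namespace Literature.NumberTheory.LFunctions

/-- **The Riemann hypothesis up to height 16**: every zero `ρ` of `ζ` with `0 < Im ρ ≤ 16` has
`Re ρ = 1/2` (Gram 1903 / Backlund 1914: `N(16) = 1 = N₀(16)`; here from the kernel-checked
certificate `Literature.NumberTheory.LFunctions.ZetaCert.RH16.theCert` and `Literature.NumberTheory.LFunctions.ZetaCert.RHCert.sound`).
[cite: Edwards1974, §6.6] -/
theorem riemannHypothesisUpTo_sixteen : DiophantineGeometry.RiemannHypothesisUpTo 16 := by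
  have h := ZetaCert.RHCert.sound ZetaCert.RH16.theCert_check
  norm_num [ZetaCert.RH16.theCert] at h
  exact h

/-- The same through the verifier interface `Literature.NumberTheory.DiophantineGeometry.RHVerifier`
(`riemannHypothesisUpTo_of_check`). [folklore] -/
example : DiophantineGeometry.RiemannHypothesisUpTo ((16 : ℕ) : ℝ) :=
  DiophantineGeometry.riemannHypothesisUpTo_of_check ZetaCert.backlundVerifier ZetaCert.RH16.theCert
    (by
      show (decide ((16 : ℕ) ≤ (16 : ℚ)) && ZetaCert.RH16.theCert.check) = true
      rw [ZetaCert.RH16.theCert_check]; decide)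

end Literature.NumberTheory.LFunctions
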